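import Literature.Probability.Percolation.ZdFourArmSepInwardExt
import HarnessLib

/-!
# Kesten's well-separated four-arm event has positive probability at bounded ratio (bond percolation on `ℤ²`), deterministic half

Topic `Literature/Probability/Percolation`; critical bond percolation on `ℤ²`. Proofs and two
auxiliary event definitions (no named fact).

A brick of the INTERNAL half of Kesten's arm-separation theorem for four alternating arms
(H. Kesten, CMP 109 (1987), §2, Lemma 5; P. Nolin, EJP 13 (2008), §4.4 part 2 and Prop. 12 (i),
Prop. 13 (lower bound) [arXiv 0711.4948: Prop. 11, Prop. 12]): the **initial-scale input**
`c ≤ P_{1/2}(zdFourArmSep m N)` for `2m ≤ N ≤ 4m` (the hypothesis `hinit` of the summation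
`real_fourArmTwoClusters_le_mul_of_scheme_inner`, `ZdFourArmSeparationStep.lean`; Nolin, proof of
Prop. 13: "the lower bound comes from iterating item (i)" — here the explicit RSW construction at one
scale).  This file is the deterministic half: the four fenced arms of `zdFourArmSep m N`
(`ZdFourArmSeparated.lean`) are BUILT from twenty-eight rectangle / face-box crossings — for each
open arm a corridor `[m, N] × [0, m/64]` (the body), the three inner crossings of
`exists_inwardFence_R/L` (new inner fence) and three outer crossings (`exists_outwardFence_R/L`,
new outer fence); for each dual arm a face corridor of the face columns `[0, m/64]` between the rows
`m - 1` and `N` (the body, cut down to its piece between the last face of the row `m - 1` and the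
first face of the row `N`), three inner and three outer face crossings.  The probabilistic half is
`ZdFourArmSepInitProb.lean`.

* `exists_outwardFence_R/L/T/B` — outer fences and attaching walks from three crossings around the
  outer endpoint (mirror images, in the radial direction, of `exists_inwardFence_R/L/T/B`);
* `ZdSepOpenArmR/L.ofPieces`, `ZdSepDualArmT/B.ofPieces` — plain constructors;
* `exists_doubleSharp_faceWalk` — from a face walk between two rows, a piece whose only faces on the
  two extreme rows are its endpoints;
* `initOpenEvents m N`, `initDualEvents m N` and **`mem_zdFourArmSep_of_mem_init`**:
  `initOpenEvents m N ∩ initDualEvents m N ⊆ zdFourArmSep m N` on lattice configurations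
  (`128 ≤ m`, `2m ≤ N ≤ 4m`).

## References

* P. Nolin, *Near-critical percolation in two dimensions*, EJP 13 (2008), §4.3 Prop. 12 (i),
  Prop. 13, §4.4 part 2 [arXiv 0711.4948: Prop. 11, Prop. 12, p. 13]. [Nolin2008]
* H. Kesten, *Scaling relations for 2D-percolation*, CMP 109 (1987), §2, Lemma 5. [KestenScalingCMP1987]

Tree: `exists_inwardFence_R/L/T/B`, `attachBound_*`, `exists_prefix_reach_le/ge_sharp`,
`dualLRFaceCrossing`, `closed_of_within`, `closed_takeUntil` (`ZdFourArmSepInwardExt.lean`);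
`ZdSepOpenArmR/L`, `ZdSepDualArmT/B`, `zdFourArmSep`; walk surgery lemmas of
`ZdFiveArmSeparatedGluing.lean`; `lrCrossingAt`, `tbCrossingAt'`, `dualFaceCrossing`.
-/

noncomputable section

open MeasureTheory Set SimpleGraph

namespace Literature.Probability.Percolation

open LatticeModels

/-! ### Plain constructors -/

section Constructors

variable {ω : BondConfig (Site 2)} {n N : ℕ} {lo hi lo' hi' : ℤ}

/-- A fenced right arm from its pieces. [folklore] -/
def ZdSepOpenArmR.ofPieces {x z : Site 2} (W : (zdGraph 2).Walk x z)
    (hx : x 0 = n ∧ lo ≤ x 1 ∧ x 1 ≤ hi) (hz : z 0 = N ∧ lo' ≤ z 1 ∧ z 1 ≤ hi')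
    (hW : ∀ v ∈ W.support, v ∈ sqAnnulus n N) (hWo : ∀ e ∈ W.edges, e ∈ ω)
    {a b u : Site 2} (V : (zdGraph 2).Walk a b) (P : (zdGraph 2).Walk z u)
    (hab : a 1 = z 1 - (N / 64 : ℕ) ∧ b 1 = z 1 + (N / 64 : ℕ))
    (hV : ∀ v ∈ V.support, (N : ℤ) + 1 ≤ v 0 ∧ v 0 ≤ N + (N / 8 : ℕ) ∧ |v 1 - z 1| ≤ (N / 64 : ℕ))
    (hVo : ∀ e ∈ V.edges, e ∈ ω) (hu : u ∈ V.support)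
    (hP : ∀ v ∈ P.support, |v 0 - z 0| + 1 ≤ (N / 8 : ℕ) ∧ |v 1 - z 1| + 1 ≤ (N / 8 : ℕ))
    (hPo : ∀ e ∈ P.edges, e ∈ ω)
    {a' b' u' : Site 2} (V' : (zdGraph 2).Walk a' b') (P' : (zdGraph 2).Walk x u')
    (hab' : a' 1 = x 1 - (n / 64 : ℕ) ∧ b' 1 = x 1 + (n / 64 : ℕ))
    (hV' : ∀ v ∈ V'.support, (n : ℤ) - (n / 8 : ℕ) ≤ v 0 ∧ v 0 + 1 ≤ n ∧ |v 1 - x 1| ≤ (n / 64 : ℕ))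
    (hV'o : ∀ e ∈ V'.edges, e ∈ ω) (hu' : u' ∈ V'.support)
    (hP' : ∀ v ∈ P'.support, |v 0 - x 0| + 1 ≤ (n / 8 : ℕ) ∧ |v 1 - x 1| + 1 ≤ (n / 8 : ℕ))
    (hP'o : ∀ e ∈ P'.edges, e ∈ ω) : ZdSepOpenArmR ω n N lo hi lo' hi' where
  x := x
  z := z
  W := W
  hx := hx
  hz := hz
  hW := hW
  hWo := hWo
  a := a
  b := b
  u := u
  V := V
  P := P
  hab := hab
  hV := hV
  hVo := hVo
  hu := hu
  hP := hP
  hPo := hPo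
  a' := a'
  b' := b'
  u' := u'
  V' := V'
  P' := P'
  hab' := hab'
  hV' := hV'
  hV'o := hV'o
  hu' := hu'
  hP' := hP'
  hP'o := hP'o

/-- A fenced left arm from its pieces. [folklore] -/
def ZdSepOpenArmL.ofPieces {x z : Site 2} (W : (zdGraph 2).Walk x z)
    (hx : x 0 = -(n : ℤ) ∧ lo ≤ x 1 ∧ x 1 ≤ hi) (hz : z 0 = -(N : ℤ) ∧ lo' ≤ z 1 ∧ z 1 ≤ hi')
    (hW : ∀ v ∈ W.support, v ∈ sqAnnulus n N) (hWo : ∀ e ∈ W.edges, e ∈ ω)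
    {a b u : Site 2} (V : (zdGraph 2).Walk a b) (P : (zdGraph 2).Walk z u)
    (hab : a 1 = z 1 - (N / 64 : ℕ) ∧ b 1 = z 1 + (N / 64 : ℕ))
    (hV : ∀ v ∈ V.support, -((N : ℤ) + (N / 8 : ℕ)) ≤ v 0 ∧ v 0 + 1 ≤ -(N : ℤ) ∧ |v 1 - z 1| ≤ (N / 64 : ℕ))
    (hVo : ∀ e ∈ V.edges, e ∈ ω) (hu : u ∈ V.support)
    (hP : ∀ v ∈ P.support, |v 0 - z 0| + 1 ≤ (N / 8 : ℕ) ∧ |v 1 - z 1| + 1 ≤ (N / 8 : ℕ))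
    (hPo : ∀ e ∈ P.edges, e ∈ ω)
    {a' b' u' : Site 2} (V' : (zdGraph 2).Walk a' b') (P' : (zdGraph 2).Walk x u')
    (hab' : a' 1 = x 1 - (n / 64 : ℕ) ∧ b' 1 = x 1 + (n / 64 : ℕ))
    (hV' : ∀ v ∈ V'.support, -(n : ℤ) + 1 ≤ v 0 ∧ v 0 ≤ -(n : ℤ) + (n / 8 : ℕ) ∧ |v 1 - x 1| ≤ (n / 64 : ℕ))
    (hV'o : ∀ e ∈ V'.edges, e ∈ ω) (hu' : u' ∈ V'.support)
    (hP' : ∀ v ∈ P'.support, |v 0 - x 0| + 1 ≤ (n / 8 : ℕ) ∧ |v 1 - x 1| + 1 ≤ (n / 8 : ℕ))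
    (hP'o : ∀ e ∈ P'.edges, e ∈ ω) : ZdSepOpenArmL ω n N lo hi lo' hi' where
  x := x
  z := z
  W := W
  hx := hx
  hz := hz
  hW := hW
  hWo := hWo
  a := a
  b := b
  u := u
  V := V
  P := P
  hab := hab
  hV := hV
  hVo := hVo
  hu := hu
  hP := hP
  hPo := hPo
  a' := a'
  b' := b'
  u' := u'
  V' := V'
  P' := P'
  hab' := hab'
  hV' := hV'
  hV'o := hV'o
  hu' := hu'
  hP' := hP'
  hP'o := hP'o

/-- A fenced top dual arm from its pieces. [folklore] -/
def ZdSepDualArmT.ofPieces {f g : Site 2} (Q : (zdGraph 2).Walk f g)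
    (hf : f 1 + 1 = n ∧ lo ≤ f 0 ∧ f 0 ≤ hi) (hg : g 1 = N ∧ lo' ≤ g 0 ∧ g 0 ≤ hi')
    (hQc : ∀ d ∈ Q.darts, sepEdge d.fst d.snd ∉ ω)
    (hQa : ∀ d ∈ Q.darts, ∀ v ∈ sepEdge d.fst d.snd, v ∈ sqAnnulus n N)
    {a b u : Site 2} (C : (zdGraph 2).Walk a b) (P : (zdGraph 2).Walk g u)
    (hab : a 0 = g 0 - (N / 64 : ℕ) ∧ b 0 = g 0 + (N / 64 : ℕ))
    (hC : ∀ w ∈ C.support, |w 0 - g 0| ≤ (N / 64 : ℕ) ∧ (N : ℤ) + 1 ≤ w 1 ∧ w 1 ≤ N + (N / 8 : ℕ))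
    (hCc : ∀ d ∈ C.darts, sepEdge d.fst d.snd ∉ ω) (hu : u ∈ C.support)
    (hP : ∀ w ∈ P.support, |w 0 - g 0| + 1 ≤ (N / 8 : ℕ) ∧ |w 1 - g 1| + 1 ≤ (N / 8 : ℕ))
    (hPc : ∀ d ∈ P.darts, sepEdge d.fst d.snd ∉ ω)
    {a' b' u' : Site 2} (C' : (zdGraph 2).Walk a' b') (P' : (zdGraph 2).Walk f u')
    (hab' : a' 0 = f 0 - (n / 64 : ℕ) ∧ b' 0 = f 0 + (n / 64 : ℕ))
    (hC' : ∀ w ∈ C'.support, |w 0 - f 0| ≤ (n / 64 : ℕ) ∧ (n : ℤ) - 1 - (n / 8 : ℕ) ≤ w 1 ∧ w 1 + 2 ≤ n)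
    (hC'c : ∀ d ∈ C'.darts, sepEdge d.fst d.snd ∉ ω) (hu' : u' ∈ C'.support)
    (hP' : ∀ w ∈ P'.support, |w 0 - f 0| + 1 ≤ (n / 8 : ℕ) ∧ |w 1 - f 1| + 1 ≤ (n / 8 : ℕ))
    (hP'c : ∀ d ∈ P'.darts, sepEdge d.fst d.snd ∉ ω) : ZdSepDualArmT ω n N lo hi lo' hi' where
  f := f
  g := g
  Q := Q
  hf := hf
  hg := hg
  hQc := hQc
  hQa := hQa
  a := a
  b := b
  u := u
  C := C
  P := P
  hab := hab
  hC := hC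
  hCc := hCc
  hu := hu
  hP := hP
  hPc := hPc
  a' := a'
  b' := b'
  u' := u'
  C' := C'
  P' := P'
  hab' := hab'
  hC' := hC'
  hC'c := hC'c
  hu' := hu'
  hP' := hP'
  hP'c := hP'c

/-- A fenced bottom dual arm from its pieces. [folklore] -/
def ZdSepDualArmB.ofPieces {f g : Site 2} (Q : (zdGraph 2).Walk f g)
    (hf : f 1 = -(n : ℤ) ∧ lo ≤ f 0 ∧ f 0 ≤ hi) (hg : g 1 + 1 = -(N : ℤ) ∧ lo' ≤ g 0 ∧ g 0 ≤ hi')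
    (hQc : ∀ d ∈ Q.darts, sepEdge d.fst d.snd ∉ ω)
    (hQa : ∀ d ∈ Q.darts, ∀ v ∈ sepEdge d.fst d.snd, v ∈ sqAnnulus n N)
    {a b u : Site 2} (C : (zdGraph 2).Walk a b) (P : (zdGraph 2).Walk g u)
    (hab : a 0 = g 0 - (N / 64 : ℕ) ∧ b 0 = g 0 + (N / 64 : ℕ))
    (hC : ∀ w ∈ C.support, |w 0 - g 0| ≤ (N / 64 : ℕ) ∧ -((N : ℤ) + 1 + (N / 8 : ℕ)) ≤ w 1 ∧ w 1 + 2 ≤ -(N : ℤ))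
    (hCc : ∀ d ∈ C.darts, sepEdge d.fst d.snd ∉ ω) (hu : u ∈ C.support)
    (hP : ∀ w ∈ P.support, |w 0 - g 0| + 1 ≤ (N / 8 : ℕ) ∧ |w 1 - g 1| + 1 ≤ (N / 8 : ℕ))
    (hPc : ∀ d ∈ P.darts, sepEdge d.fst d.snd ∉ ω)
    {a' b' u' : Site 2} (C' : (zdGraph 2).Walk a' b') (P' : (zdGraph 2).Walk f u')
    (hab' : a' 0 = f 0 - (n / 64 : ℕ) ∧ b' 0 = f 0 + (n / 64 : ℕ))
    (hC' : ∀ w ∈ C'.support, |w 0 - f 0| ≤ (n / 64 : ℕ) ∧ -(n : ℤ) + 1 ≤ w 1 ∧ w 1 ≤ -(n : ℤ) + (n / 8 : ℕ))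
    (hC'c : ∀ d ∈ C'.darts, sepEdge d.fst d.snd ∉ ω) (hu' : u' ∈ C'.support)
    (hP' : ∀ w ∈ P'.support, |w 0 - f 0| + 1 ≤ (n / 8 : ℕ) ∧ |w 1 - f 1| + 1 ≤ (n / 8 : ℕ))
    (hP'c : ∀ d ∈ P'.darts, sepEdge d.fst d.snd ∉ ω) : ZdSepDualArmB ω n N lo hi lo' hi' where
  f := f
  g := g
  Q := Q
  hf := hf
  hg := hg
  hQc := hQc
  hQa := hQa
  a := a
  b := b
  u := u
  C := C
  P := P
  hab := hab
  hC := hC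
  hCc := hCc
  hu := hu
  hP := hP
  hPc := hPc
  a' := a'
  b' := b'
  u' := u'
  C' := C'
  P' := P'
  hab' := hab'
  hC' := hC'
  hC'c := hC'c
  hu' := hu'
  hP' := hP'
  hP'c := hP'c

end Constructors

/-! ### Outer fences from three crossings around the outer endpoint -/

section OutwardFence

variable {ω : BondConfig (Site 2)} {N : ℕ}

/-- Numerical bound for the outer attaching walks (right side): sites in
`[N - N/16, N + N/8 - 1] × [-N/64, 2·N/64]` are within sup-distance `< N/8` of `(N, z₁)`,
`0 ≤ z₁ ≤ N/64`. [folklore] -/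
theorem attachBound_outR (hN : 64 ≤ N) {v0 v1 z0 z1 : ℤ} (hz0 : z0 = N) (hz1 : 0 ≤ z1 ∧ z1 ≤ (N / 64 : ℕ))
    (h0 : (N : ℤ) - (N / 16 : ℕ) ≤ v0) (h0' : v0 + 1 ≤ (N : ℤ) + (N / 8 : ℕ))
    (h1 : -((N / 64 : ℕ) : ℤ) ≤ v1) (h1' : v1 ≤ 2 * ((N / 64 : ℕ) : ℤ)) :
    |v0 - z0| + 1 ≤ (N / 8 : ℕ) ∧ |v1 - z1| + 1 ≤ (N / 8 : ℕ) := by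
  constructor
  · have : |v0 - z0| ≤ ((N / 8 : ℕ) : ℤ) - 1 := abs_sub_le_iff.2 ⟨by omega, by omega⟩
    omega
  · have : |v1 - z1| ≤ 2 * ((N / 64 : ℕ) : ℤ) := abs_sub_le_iff.2 ⟨by omega, by omega⟩
    omega

/-- The mirror image of `attachBound_outR` (left side, outer endpoint `(-N, z₁)`). [folklore] -/
theorem attachBound_outL (hN : 64 ≤ N) {v0 v1 z0 z1 : ℤ} (hz0 : z0 = -(N : ℤ)) (hz1 : 0 ≤ z1 ∧ z1 ≤ (N / 64 : ℕ))
    (h0 : -((N : ℤ) + (N / 8 : ℕ)) + 1 ≤ v0) (h0' : v0 ≤ -(N : ℤ) + (N / 16 : ℕ))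
    (h1 : -((N / 64 : ℕ) : ℤ) ≤ v1) (h1' : v1 ≤ 2 * ((N / 64 : ℕ) : ℤ)) :
    |v0 - z0| + 1 ≤ (N / 8 : ℕ) ∧ |v1 - z1| + 1 ≤ (N / 8 : ℕ) := by
  constructor
  · have : |v0 - z0| ≤ ((N / 8 : ℕ) : ℤ) - 1 := abs_sub_le_iff.2 ⟨by omega, by omega⟩
    omega
  · have : |v1 - z1| ≤ 2 * ((N / 64 : ℕ) : ℤ) := abs_sub_le_iff.2 ⟨by omega, by omega⟩
    omega

/-- Numerical bound for the outer attaching walks of the top dual arm: faces in the columns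
`[-N/64, 2·N/64]` and rows `[N - N/16 + 1, N + N/8 - 1]`, end face `(g₀, N)`, `0 ≤ g₀ ≤ N/64`. [folklore] -/
theorem attachBound_outT (hN : 64 ≤ N) {w0 w1 g0 g1 : ℤ} (hg0 : 0 ≤ g0 ∧ g0 ≤ (N / 64 : ℕ)) (hg1 : g1 = N)
    (h0 : -((N / 64 : ℕ) : ℤ) ≤ w0) (h0' : w0 ≤ 2 * ((N / 64 : ℕ) : ℤ))
    (h1 : (N : ℤ) - (N / 16 : ℕ) + 1 ≤ w1) (h1' : w1 + 1 ≤ (N : ℤ) + (N / 8 : ℕ)) :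
    |w0 - g0| + 1 ≤ (N / 8 : ℕ) ∧ |w1 - g1| + 1 ≤ (N / 8 : ℕ) := by
  constructor
  · have : |w0 - g0| ≤ 2 * ((N / 64 : ℕ) : ℤ) := abs_sub_le_iff.2 ⟨by omega, by omega⟩
    omega
  · have : |w1 - g1| ≤ ((N / 8 : ℕ) : ℤ) - 1 := abs_sub_le_iff.2 ⟨by omega, by omega⟩
    omega

/-- Numerical bound for the outer attaching walks of the bottom dual arm: rows
`[-N - N/8, -N + N/16 - 2]`, end face `(g₀, -N - 1)`. [folklore] -/
theorem attachBound_outB (hN : 64 ≤ N) {w0 w1 g0 g1 : ℤ} (hg0 : 0 ≤ g0 ∧ g0 ≤ (N / 64 : ℕ)) (hg1 : g1 + 1 = -(N : ℤ))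
    (h0 : -((N / 64 : ℕ) : ℤ) ≤ w0) (h0' : w0 ≤ 2 * ((N / 64 : ℕ) : ℤ))
    (h1 : -(N : ℤ) - (N / 8 : ℕ) ≤ w1) (h1' : w1 + 2 ≤ -(N : ℤ) + (N / 16 : ℕ)) :
    |w0 - g0| + 1 ≤ (N / 8 : ℕ) ∧ |w1 - g1| + 1 ≤ (N / 8 : ℕ) := by
  constructor
  · have : |w0 - g0| ≤ 2 * ((N / 64 : ℕ) : ℤ) := abs_sub_le_iff.2 ⟨by omega, by omega⟩
    omega
  · have : |w1 - g1| ≤ ((N / 8 : ℕ) : ℤ) - 1 := abs_sub_le_iff.2 ⟨by omega, by omega⟩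
    omega

/-- **Outer fence of the right arm from three crossings.**  Let `G` be an open walk ending at
`z = (N, z₁)` (`0 ≤ z₁ ≤ N/64`) inside `{X ≤ x₀ ≤ N} × [0, N/64]` with `X ≤ N - N/16` (the end of the
body), `H₀` an open left–right crossing of `[N - N/16, N + N/8 - 1] × [0, N/64]`, `V₀` an open
top–bottom crossing of `[N - N/16, N - 1] × [-N/64, 2·N/64]` and `V` one of
`[N + 1, N + N/8 - 1] × [-N/64, 2·N/64]`.  Then the segment of `V` across the rows `[z₁ - N/64, z₁ + N/64]`
is an outer fence crossing attached to `z` within sup-distance `< N/8` (along `G`, `V₀`, `H₀`).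
[cite: Nolin2008, §4.2 Def. 6 (free spaces) and §4.3 proof of Prop. 12 (i) (arXiv 0711.4948)] -/
theorem exists_outwardFence_R (hN : 64 ≤ N) {X : ℤ} (hX : X + (N / 16 : ℕ) ≤ N)
    {s z : Site 2} (G : (zdGraph 2).Walk s z) (hs : s 0 = X) (hz : z 0 = N)
    (hG : ∀ v ∈ G.support, X ≤ v 0 ∧ v 0 ≤ N ∧ 0 ≤ v 1 ∧ v 1 ≤ (N / 64 : ℕ))
    (hGo : ∀ e ∈ G.edges, e ∈ ω)
    {s₀ y₀ : Site 2} (H₀ : (zdGraph 2).Walk s₀ y₀) (hs₀ : s₀ 0 = (N : ℤ) - (N / 16 : ℕ))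
    (hy₀ : y₀ 0 + 1 = (N : ℤ) + (N / 8 : ℕ))
    (hH₀ : ∀ v ∈ H₀.support, (N : ℤ) - (N / 16 : ℕ) ≤ v 0 ∧ v 0 + 1 ≤ (N : ℤ) + (N / 8 : ℕ) ∧
      0 ≤ v 1 ∧ v 1 ≤ (N / 64 : ℕ))
    (hH₀o : ∀ e ∈ H₀.edges, e ∈ ω)
    {p₀ q₀ : Site 2} (V₀ : (zdGraph 2).Walk p₀ q₀) (hp₀ : p₀ 1 = -((N / 64 : ℕ) : ℤ))
    (hq₀ : q₀ 1 = 2 * ((N / 64 : ℕ) : ℤ))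
    (hV₀ : ∀ v ∈ V₀.support, (N : ℤ) - (N / 16 : ℕ) ≤ v 0 ∧ v 0 + 1 ≤ N ∧
      -((N / 64 : ℕ) : ℤ) ≤ v 1 ∧ v 1 ≤ 2 * ((N / 64 : ℕ) : ℤ))
    (hV₀o : ∀ e ∈ V₀.edges, e ∈ ω)
    {p₁ q₁ : Site 2} (V : (zdGraph 2).Walk p₁ q₁) (hp₁ : p₁ 1 = -((N / 64 : ℕ) : ℤ))
    (hq₁ : q₁ 1 = 2 * ((N / 64 : ℕ) : ℤ))
    (hV : ∀ v ∈ V.support, (N : ℤ) + 1 ≤ v 0 ∧ v 0 + 1 ≤ (N : ℤ) + (N / 8 : ℕ) ∧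
      -((N / 64 : ℕ) : ℤ) ≤ v 1 ∧ v 1 ≤ 2 * ((N / 64 : ℕ) : ℤ))
    (hVo : ∀ e ∈ V.edges, e ∈ ω) :
    ∃ (a b u : Site 2) (V' : (zdGraph 2).Walk a b) (P : (zdGraph 2).Walk z u),
      (a 1 = z 1 - (N / 64 : ℕ) ∧ b 1 = z 1 + (N / 64 : ℕ)) ∧
      (∀ v ∈ V'.support, (N : ℤ) + 1 ≤ v 0 ∧ v 0 ≤ N + (N / 8 : ℕ) ∧ |v 1 - z 1| ≤ (N / 64 : ℕ)) ∧
      (∀ e ∈ V'.edges, e ∈ ω) ∧ u ∈ V'.support ∧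
      (∀ v ∈ P.support, |v 0 - z 0| + 1 ≤ (N / 8 : ℕ) ∧ |v 1 - z 1| + 1 ≤ (N / 8 : ℕ)) ∧
      ∀ e ∈ P.edges, e ∈ ω := by
  classical
  have hz1 := hG z G.end_mem_support
  -- the fence crossing: the segment of `V` across the rows `[z₁ - N/64, z₁ + N/64]`
  obtain ⟨a, b, Vs, ha, hb, hVs, hVse⟩ := exists_segment_between 1 V (z 1 - (N / 64 : ℕ))
    (z 1 + (N / 64 : ℕ)) (by rw [hp₁]; omega) (by rw [hq₁]; omega) (by omega)
  -- `H₀` between the columns `N + 1` and `N + N/8 - 1` meets it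
  obtain ⟨pa, pb, H₀s, hpa, hpb, hH₀s, -⟩ := exists_segment_between 0 H₀ ((N : ℤ) + 1)
    ((N : ℤ) + (N / 8 : ℕ) - 1) (by rw [hs₀]; omega) (by omega) (by omega)
  obtain ⟨u, huH, huV⟩ := exists_mem_support_of_vFence (L := (N : ℤ) + 1)
    (R := (N : ℤ) + (N / 8 : ℕ) - 1) (B₀ := 0) (B₁ := ((N / 64 : ℕ) : ℤ)) Vs
    (fun v hv => ⟨(hV v (hVs v hv).2.2).1, by have := (hV v (hVs v hv).2.2).2.1; omega⟩)
    (by rw [ha]; omega) (by rw [hb]; omega) (by omega) H₀s hpa hpb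
    (fun v hv => ⟨(hH₀s v hv).1, (hH₀s v hv).2.1, (hH₀ v (hH₀s v hv).2.2).2.2.1, (hH₀ v (hH₀s v hv).2.2).2.2.2⟩)
  -- `H₀` up to the column `N - 1` meets `V₀`
  obtain ⟨qh, H₀p, hqh, hH₀p, -⟩ := exists_prefix_reach_ge 0 H₀ ((N : ℤ) - 1) (by rw [hs₀]; omega)
    (by omega)
  obtain ⟨v₁, hv₁H, hv₁V⟩ := exists_mem_support_of_vFence (L := (N : ℤ) - (N / 16 : ℕ))
    (R := (N : ℤ) - 1) (B₀ := 0) (B₁ := ((N / 64 : ℕ) : ℤ)) V₀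
    (fun v hv => ⟨(hV₀ v hv).1, by have := (hV₀ v hv).2.1; omega⟩) (by rw [hp₀]; omega)
    (by rw [hq₀]; omega) (by omega) H₀p hs₀ hqh
    (fun v hv => ⟨(hH₀ v (hH₀p v hv).2).1, (hH₀p v hv).1, (hH₀ v (hH₀p v hv).2).2.2.1,
      (hH₀ v (hH₀p v hv).2).2.2.2⟩)
  -- `G` after its last visit to the column `N - N/16` meets `V₀`
  obtain ⟨qg, Gp, hqg, hGp, hGpe⟩ := exists_prefix_reach_le 0 G.reverse ((N : ℤ) - (N / 16 : ℕ))
    (by rw [hz]; omega) (by rw [hs]; omega)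
  obtain ⟨ra, rb, Gs, hra, hrb, hGs, -⟩ := exists_segment_between 0 Gp.reverse ((N : ℤ) - (N / 16 : ℕ))
    ((N : ℤ) - 1) (by rw [hqg]) (by rw [hz]; omega) (by omega)
  obtain ⟨v₀, hv₀G, hv₀V⟩ := exists_mem_support_of_vFence (L := (N : ℤ) - (N / 16 : ℕ))
    (R := (N : ℤ) - 1) (B₀ := 0) (B₁ := ((N / 64 : ℕ) : ℤ)) V₀
    (fun v hv => ⟨(hV₀ v hv).1, by have := (hV₀ v hv).2.1; omega⟩) (by rw [hp₀]; omega)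
    (by rw [hq₀]; omega) (by omega) Gs hra hrb
    (fun v hv => by
      obtain ⟨h0, h0', hv'⟩ := hGs v hv
      rw [Walk.support_reverse, List.mem_reverse] at hv'
      have h := hG v (by have := (hGp v hv').2; rwa [Walk.support_reverse, List.mem_reverse] at this)
      exact ⟨h0, h0', h.2.2.1, h.2.2.2⟩)
  have hv₀Gp : v₀ ∈ Gp.support := by
    have := (hGs v₀ hv₀G).2.2; rwa [Walk.support_reverse, List.mem_reverse] at this
  -- the attaching walk
  obtain ⟨X₁, hX₁s, hX₁e⟩ := exists_walk_within_support V₀ hv₀V hv₁V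
  obtain ⟨X₂, hX₂s, hX₂e⟩ := exists_walk_within_support H₀ (hH₀p v₁ hv₁H).2 (hH₀s u huH).2.2
  refine ⟨a, b, u, Vs, (Gp.takeUntil v₀ hv₀Gp).append (X₁.append X₂), ⟨ha, hb⟩,
    fun v hv => ?_, fun e he => hVo e (hVse e he), huV, fun v hv => ?_, fun e he => ?_⟩
  · obtain ⟨h1, h1', hv'⟩ := hVs v hv
    obtain ⟨h0, h0', -, -⟩ := hV v hv'
    exact ⟨h0, by omega, abs_le.2 ⟨by omega, by omega⟩⟩
  · rw [Walk.mem_support_append_iff, Walk.mem_support_append_iff] at hv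
    rcases hv with hv | hv | hv
    · have h := hGp v (Gp.support_takeUntil_subset_support hv₀Gp hv)
      have h' := hG v (by have := h.2; rwa [Walk.support_reverse, List.mem_reverse] at this)
      exact attachBound_outR hN hz ⟨hz1.2.2.1, hz1.2.2.2⟩ h.1 (by omega) (by omega) (by omega)
    · obtain ⟨h0, h0', h1, h1'⟩ := hV₀ v (hX₁s v hv)
      exact attachBound_outR hN hz ⟨hz1.2.2.1, hz1.2.2.2⟩ h0 (by omega) h1 h1'
    · obtain ⟨h0, h0', h1, h1'⟩ := hH₀ v (hX₂s v hv)
      exact attachBound_outR hN hz ⟨hz1.2.2.1, hz1.2.2.2⟩ h0 h0' (by omega) (by omega)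
  · rw [Walk.edges_append, List.mem_append, Walk.edges_append, List.mem_append] at he
    rcases he with he | he | he
    · have := hGpe e (Gp.edges_takeUntil_subset_edges hv₀Gp he)
      rw [Walk.edges_reverse, List.mem_reverse] at this
      exact hGo e this
    · exact hV₀o e (hX₁e e he)
    · exact hH₀o e (hX₂e e he)

/-- **Outer fence of the left arm from three crossings** (mirror image of `exists_outwardFence_R`):
`G` ends at `z = (-N, z₁)` inside `{-N ≤ x₀ ≤ X}`, `-N + N/16 ≤ X`; `H₀` crosses
`[-N - N/8 + 1, -N + N/16] × [0, N/64]` (given from its RIGHT column), `V₀` crosses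
`[-N + 1, -N + N/16] × [-N/64, 2·N/64]` and `V` crosses `[-N - N/8 + 1, -N - 1] × [-N/64, 2·N/64]` top
to bottom. [cite: Nolin2008, §4.2 Def. 6 and §4.3 proof of Prop. 12 (i) (arXiv 0711.4948)] -/
theorem exists_outwardFence_L (hN : 64 ≤ N) {X : ℤ} (hX : -(N : ℤ) + (N / 16 : ℕ) ≤ X)
    {s z : Site 2} (G : (zdGraph 2).Walk s z) (hs : s 0 = X) (hz : z 0 = -(N : ℤ))
    (hG : ∀ v ∈ G.support, -(N : ℤ) ≤ v 0 ∧ v 0 ≤ X ∧ 0 ≤ v 1 ∧ v 1 ≤ (N / 64 : ℕ))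
    (hGo : ∀ e ∈ G.edges, e ∈ ω)
    {s₀ y₀ : Site 2} (H₀ : (zdGraph 2).Walk s₀ y₀) (hs₀ : s₀ 0 = -(N : ℤ) + (N / 16 : ℕ))
    (hy₀ : y₀ 0 = -(N : ℤ) - (N / 8 : ℕ) + 1)
    (hH₀ : ∀ v ∈ H₀.support, -(N : ℤ) - (N / 8 : ℕ) + 1 ≤ v 0 ∧ v 0 ≤ -(N : ℤ) + (N / 16 : ℕ) ∧
      0 ≤ v 1 ∧ v 1 ≤ (N / 64 : ℕ))
    (hH₀o : ∀ e ∈ H₀.edges, e ∈ ω)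
    {p₀ q₀ : Site 2} (V₀ : (zdGraph 2).Walk p₀ q₀) (hp₀ : p₀ 1 = -((N / 64 : ℕ) : ℤ))
    (hq₀ : q₀ 1 = 2 * ((N / 64 : ℕ) : ℤ))
    (hV₀ : ∀ v ∈ V₀.support, -(N : ℤ) + 1 ≤ v 0 ∧ v 0 ≤ -(N : ℤ) + (N / 16 : ℕ) ∧
      -((N / 64 : ℕ) : ℤ) ≤ v 1 ∧ v 1 ≤ 2 * ((N / 64 : ℕ) : ℤ))
    (hV₀o : ∀ e ∈ V₀.edges, e ∈ ω)
    {p₁ q₁ : Site 2} (V : (zdGraph 2).Walk p₁ q₁) (hp₁ : p₁ 1 = -((N / 64 : ℕ) : ℤ))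
    (hq₁ : q₁ 1 = 2 * ((N / 64 : ℕ) : ℤ))
    (hV : ∀ v ∈ V.support, -(N : ℤ) - (N / 8 : ℕ) + 1 ≤ v 0 ∧ v 0 + 1 ≤ -(N : ℤ) ∧
      -((N / 64 : ℕ) : ℤ) ≤ v 1 ∧ v 1 ≤ 2 * ((N / 64 : ℕ) : ℤ))
    (hVo : ∀ e ∈ V.edges, e ∈ ω) :
    ∃ (a b u : Site 2) (V' : (zdGraph 2).Walk a b) (P : (zdGraph 2).Walk z u),
      (a 1 = z 1 - (N / 64 : ℕ) ∧ b 1 = z 1 + (N / 64 : ℕ)) ∧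
      (∀ v ∈ V'.support, -((N : ℤ) + (N / 8 : ℕ)) ≤ v 0 ∧ v 0 + 1 ≤ -(N : ℤ) ∧ |v 1 - z 1| ≤ (N / 64 : ℕ)) ∧
      (∀ e ∈ V'.edges, e ∈ ω) ∧ u ∈ V'.support ∧
      (∀ v ∈ P.support, |v 0 - z 0| + 1 ≤ (N / 8 : ℕ) ∧ |v 1 - z 1| + 1 ≤ (N / 8 : ℕ)) ∧
      ∀ e ∈ P.edges, e ∈ ω := by
  classical
  have hz1 := hG z G.end_mem_support
  -- the fence crossing
  obtain ⟨a, b, Vs, ha, hb, hVs, hVse⟩ := exists_segment_between 1 V (z 1 - (N / 64 : ℕ))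
    (z 1 + (N / 64 : ℕ)) (by rw [hp₁]; omega) (by rw [hq₁]; omega) (by omega)
  -- `H₀` (reversed: from the column `-N - N/8 + 1` rightwards) between the columns
  -- `-N - N/8 + 1` and `-N - 1` meets it
  obtain ⟨pa, pb, H₀s, hpa, hpb, hH₀s, -⟩ := exists_segment_between 0 H₀.reverse (-(N : ℤ) - (N / 8 : ℕ) + 1)
    (-(N : ℤ) - 1) (by rw [hy₀]) (by rw [hs₀]; omega) (by omega)
  obtain ⟨u, huH, huV⟩ := exists_mem_support_of_vFence (L := -(N : ℤ) - (N / 8 : ℕ) + 1)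
    (R := -(N : ℤ) - 1) (B₀ := 0) (B₁ := ((N / 64 : ℕ) : ℤ)) Vs
    (fun v hv => ⟨(hV v (hVs v hv).2.2).1, by have := (hV v (hVs v hv).2.2).2.1; omega⟩)
    (by rw [ha]; omega) (by rw [hb]; omega) (by omega) H₀s hpa hpb
    (fun v hv => by
      obtain ⟨h0, h0', hv'⟩ := hH₀s v hv
      rw [Walk.support_reverse, List.mem_reverse] at hv'
      exact ⟨h0, h0', (hH₀ v hv').2.2.1, (hH₀ v hv').2.2.2⟩)
  replace huH : u ∈ H₀.support := by
    have := (hH₀s u huH).2.2; rwa [Walk.support_reverse, List.mem_reverse] at this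
  -- `H₀` down to the column `-N + 1` meets `V₀`
  obtain ⟨qh, H₀p, hqh, hH₀p, -⟩ := exists_prefix_reach_le 0 H₀ (-(N : ℤ) + 1) (by rw [hs₀]; omega)
    (by rw [hy₀]; omega)
  obtain ⟨v₁, hv₁H, hv₁V⟩ := exists_mem_support_of_vFence (L := -(N : ℤ) + 1)
    (R := -(N : ℤ) + (N / 16 : ℕ)) (B₀ := 0) (B₁ := ((N / 64 : ℕ) : ℤ)) V₀
    (fun v hv => ⟨(hV₀ v hv).1, (hV₀ v hv).2.1⟩) (by rw [hp₀]; omega)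
    (by rw [hq₀]; omega) (by omega) H₀p.reverse hqh hs₀
    (fun v hv => by
      rw [Walk.support_reverse, List.mem_reverse] at hv
      exact ⟨(hH₀p v hv).1, (hH₀ v (hH₀p v hv).2).2.1, (hH₀ v (hH₀p v hv).2).2.2.1,
        (hH₀ v (hH₀p v hv).2).2.2.2⟩)
  replace hv₁H : v₁ ∈ H₀.support := by
    rw [Walk.support_reverse, List.mem_reverse] at hv₁H; exact (hH₀p v₁ hv₁H).2
  -- `G` after its last visit to the column `-N + N/16` meets `V₀`
  obtain ⟨qg, Gp, hqg, hGp, hGpe⟩ := exists_prefix_reach_ge 0 G.reverse (-(N : ℤ) + (N / 16 : ℕ))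
    (by rw [hz]; omega) (by rw [hs]; omega)
  obtain ⟨ra, rb, Gs, hra, hrb, hGs, -⟩ := exists_segment_between 0 Gp (-(N : ℤ) + 1)
    (-(N : ℤ) + (N / 16 : ℕ)) (by rw [hz]; omega) (by rw [hqg]) (by omega)
  obtain ⟨v₀, hv₀G, hv₀V⟩ := exists_mem_support_of_vFence (L := -(N : ℤ) + 1)
    (R := -(N : ℤ) + (N / 16 : ℕ)) (B₀ := 0) (B₁ := ((N / 64 : ℕ) : ℤ)) V₀
    (fun v hv => ⟨(hV₀ v hv).1, (hV₀ v hv).2.1⟩) (by rw [hp₀]; omega)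
    (by rw [hq₀]; omega) (by omega) Gs hra hrb
    (fun v hv => by
      obtain ⟨h0, h0', hv'⟩ := hGs v hv
      have h := hG v (by have := (hGp v hv').2; rwa [Walk.support_reverse, List.mem_reverse] at this)
      exact ⟨h0, h0', h.2.2.1, h.2.2.2⟩)
  have hv₀Gp : v₀ ∈ Gp.support := (hGs v₀ hv₀G).2.2
  -- the attaching walk
  obtain ⟨X₁, hX₁s, hX₁e⟩ := exists_walk_within_support V₀ hv₀V hv₁V
  obtain ⟨X₂, hX₂s, hX₂e⟩ := exists_walk_within_support H₀ hv₁H huH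
  refine ⟨a, b, u, Vs, (Gp.takeUntil v₀ hv₀Gp).append (X₁.append X₂), ⟨ha, hb⟩,
    fun v hv => ?_, fun e he => hVo e (hVse e he), huV, fun v hv => ?_, fun e he => ?_⟩
  · obtain ⟨h1, h1', hv'⟩ := hVs v hv
    obtain ⟨h0, h0', -, -⟩ := hV v hv'
    exact ⟨by omega, h0', abs_le.2 ⟨by omega, by omega⟩⟩
  · rw [Walk.mem_support_append_iff, Walk.mem_support_append_iff] at hv
    rcases hv with hv | hv | hv
    · have h := hGp v (Gp.support_takeUntil_subset_support hv₀Gp hv)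
      have h' := hG v (by have := h.2; rwa [Walk.support_reverse, List.mem_reverse] at this)
      exact attachBound_outL hN hz ⟨hz1.2.2.1, hz1.2.2.2⟩ (by omega) h.1 (by omega) (by omega)
    · obtain ⟨h0, h0', h1, h1'⟩ := hV₀ v (hX₁s v hv)
      exact attachBound_outL hN hz ⟨hz1.2.2.1, hz1.2.2.2⟩ (by omega) h0' h1 h1'
    · obtain ⟨h0, h0', h1, h1'⟩ := hH₀ v (hX₂s v hv)
      exact attachBound_outL hN hz ⟨hz1.2.2.1, hz1.2.2.2⟩ (by omega) h0' (by omega) (by omega)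
  · rw [Walk.edges_append, List.mem_append, Walk.edges_append, List.mem_append] at he
    rcases he with he | he | he
    · have := hGpe e (Gp.edges_takeUntil_subset_edges hv₀Gp he)
      rw [Walk.edges_reverse, List.mem_reverse] at this
      exact hGo e this
    · exact hV₀o e (hX₁e e he)
    · exact hH₀o e (hX₂e e he)

/-- **Outer fence of the top dual arm from three face crossings.**  Let `G` be a face walk ending at
the face `g = (g₀, N)` (`0 ≤ g₀ ≤ E ≤ N/64`), with faces in the columns `[0, E]` and rows `[Y, N]`,
`Y + N/16 ≤ N`, crossing closed edges; `Hd` a closed-dual left-to-right crossing of the face box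
`[-N/64, 2·N/64] × [N - N/16 + 1, N - 1]`, `Vd` a closed-dual face walk of the face columns `[0, N/64]`
from the row `N + N/8 - 1` down to the row `N - N/16 + 1`, `Cd` a closed-dual left-to-right crossing of
`[-N/64, 2·N/64] × [N + 1, N + N/8 - 1]`.  Then a segment of `Cd` is an outer fence crossing of the
dual arm attached to `g` within sup-distance `< N/8`. [cite: Nolin2008, §4.2 Def. 6 (free spaces, dual colour) and §4.3 proof of Prop. 12 (i) (arXiv 0711.4948)] -/
theorem exists_outwardFence_T (hN : 64 ≤ N) {Y E : ℤ} (hY : Y + (N / 16 : ℕ) ≤ N)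
    (hE : 0 ≤ E ∧ E ≤ (N / 64 : ℕ))
    {q g : Site 2} (G : (zdGraph 2).Walk q g) (hq : q 1 = Y) (hg : g 1 = N)
    (hG : ∀ f ∈ G.support, 0 ≤ f 0 ∧ f 0 ≤ E ∧ Y ≤ f 1 ∧ f 1 ≤ N)
    (hGc : ∀ d ∈ G.darts, sepEdge d.fst d.snd ∉ ω)
    {xa xb : Site 2} (Hd : (zdGraph 2).Walk xa xb) (hxa : xa 0 = -((N / 64 : ℕ) : ℤ))
    (hxb : xb 0 = 2 * ((N / 64 : ℕ) : ℤ))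
    (hHd : ∀ f ∈ Hd.support, -((N / 64 : ℕ) : ℤ) ≤ f 0 ∧ f 0 ≤ 2 * ((N / 64 : ℕ) : ℤ) ∧
      (N : ℤ) - (N / 16 : ℕ) + 1 ≤ f 1 ∧ f 1 + 1 ≤ N)
    (hHdc : ∀ d ∈ Hd.darts, sepEdge d.fst d.snd ∉ ω)
    {va vb : Site 2} (Vd : (zdGraph 2).Walk va vb) (hva : va 1 + 1 = (N : ℤ) + (N / 8 : ℕ))
    (hvb : vb 1 = (N : ℤ) - (N / 16 : ℕ) + 1)
    (hVd : ∀ f ∈ Vd.support, 0 ≤ f 0 ∧ f 0 ≤ (N / 64 : ℕ) ∧ (N : ℤ) - (N / 16 : ℕ) + 1 ≤ f 1 ∧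
      f 1 + 1 ≤ (N : ℤ) + (N / 8 : ℕ))
    (hVdc : ∀ d ∈ Vd.darts, sepEdge d.fst d.snd ∉ ω)
    {ya yb : Site 2} (Cd : (zdGraph 2).Walk ya yb) (hya : ya 0 = -((N / 64 : ℕ) : ℤ))
    (hyb : yb 0 = 2 * ((N / 64 : ℕ) : ℤ))
    (hCd : ∀ f ∈ Cd.support, -((N / 64 : ℕ) : ℤ) ≤ f 0 ∧ f 0 ≤ 2 * ((N / 64 : ℕ) : ℤ) ∧
      (N : ℤ) + 1 ≤ f 1 ∧ f 1 + 1 ≤ (N : ℤ) + (N / 8 : ℕ))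
    (hCdc : ∀ d ∈ Cd.darts, sepEdge d.fst d.snd ∉ ω) :
    ∃ (a b u : Site 2) (C : (zdGraph 2).Walk a b) (P : (zdGraph 2).Walk g u),
      (a 0 = g 0 - (N / 64 : ℕ) ∧ b 0 = g 0 + (N / 64 : ℕ)) ∧
      (∀ w ∈ C.support, |w 0 - g 0| ≤ (N / 64 : ℕ) ∧ (N : ℤ) + 1 ≤ w 1 ∧ w 1 ≤ N + (N / 8 : ℕ)) ∧
      (∀ d ∈ C.darts, sepEdge d.fst d.snd ∉ ω) ∧ u ∈ C.support ∧
      (∀ w ∈ P.support, |w 0 - g 0| + 1 ≤ (N / 8 : ℕ) ∧ |w 1 - g 1| + 1 ≤ (N / 8 : ℕ)) ∧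
      ∀ d ∈ P.darts, sepEdge d.fst d.snd ∉ ω := by
  classical
  have hg' := hG g G.end_mem_support
  -- the fence crossing: the segment of `Cd` between the columns `g₀ - N/64` and `g₀ + N/64`
  obtain ⟨a, b, Cs, ha, hb, hCs, hCse⟩ := exists_segment_between 0 Cd (g 0 - (N / 64 : ℕ))
    (g 0 + (N / 64 : ℕ)) (by rw [hya]; omega) (by rw [hyb]; omega) (by omega)
  have hCsc : ∀ d ∈ Cs.darts, sepEdge d.fst d.snd ∉ ω := forall_darts_sepEdge_notMem_of_edges Cd hCdc Cs hCse
  -- `G` after its last visit to the row `N - N/16 + 1` meets `Hd`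
  obtain ⟨qk, Gp, hqk, hGp, hGpe⟩ := exists_prefix_reach_le 1 G.reverse ((N : ℤ) - (N / 16 : ℕ) + 1)
    (by rw [hg]; omega) (by rw [hq]; omega)
  obtain ⟨pa, pb, Gs, hpa, hpb, hGs, -⟩ := exists_segment_between 1 Gp.reverse
    ((N : ℤ) - (N / 16 : ℕ) + 1) ((N : ℤ) - 1) (by rw [hqk]) (by rw [hg]; omega) (by omega)
  obtain ⟨v₀, hv₀G, hv₀H⟩ := exists_mem_support_of_hFence (L₀ := 0) (L₁ := E)
    (B := (N : ℤ) - (N / 16 : ℕ) + 1) (B' := (N : ℤ) - 1) Hd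
    (fun f hf => ⟨(hHd f hf).2.2.1, by have := (hHd f hf).2.2.2; omega⟩) (by rw [hxa]; omega)
    (by rw [hxb]; omega) hE.1 Gs hpa hpb
    (fun f hf => by
      obtain ⟨h1, h1', hf'⟩ := hGs f hf
      rw [Walk.support_reverse, List.mem_reverse] at hf'
      have h := hG f (by have := (hGp f hf').2; rwa [Walk.support_reverse, List.mem_reverse] at this)
      exact ⟨h.1, h.2.1, h1, h1'⟩)
  have hv₀Gp : v₀ ∈ Gp.support := by
    have := (hGs v₀ hv₀G).2.2; rwa [Walk.support_reverse, List.mem_reverse] at this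
  -- `Vd` reversed, between the rows `N - N/16 + 1` and `N - 1`, meets `Hd`
  obtain ⟨ra, rb, Vs, hra, hrb, hVs, -⟩ := exists_segment_between 1 Vd.reverse
    ((N : ℤ) - (N / 16 : ℕ) + 1) ((N : ℤ) - 1) (by rw [hvb]) (by omega) (by omega)
  obtain ⟨v₁, hv₁V, hv₁H⟩ := exists_mem_support_of_hFence (L₀ := 0) (L₁ := ((N / 64 : ℕ) : ℤ))
    (B := (N : ℤ) - (N / 16 : ℕ) + 1) (B' := (N : ℤ) - 1) Hd
    (fun f hf => ⟨(hHd f hf).2.2.1, by have := (hHd f hf).2.2.2; omega⟩) (by rw [hxa]; omega)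
    (by rw [hxb]; omega) (by omega) Vs hra hrb
    (fun f hf => by
      obtain ⟨h1, h1', hf'⟩ := hVs f hf
      rw [Walk.support_reverse, List.mem_reverse] at hf'
      exact ⟨(hVd f hf').1, (hVd f hf').2.1, h1, h1'⟩)
  replace hv₁V : v₁ ∈ Vd.support := by
    have := (hVs v₁ hv₁V).2.2; rwa [Walk.support_reverse, List.mem_reverse] at this
  -- the segment of the fence crossing between the columns `0` and `N/64` meets `Vd`
  obtain ⟨sa, sb, Css, hsa, hsb, hCss, -⟩ := exists_segment_between 0 Cs 0 ((N / 64 : ℕ) : ℤ)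
    (by rw [ha]; omega) (by rw [hb]; omega) (by omega)
  obtain ⟨u, huC, huV⟩ := exists_mem_support_of_vFence (L := 0) (R := ((N / 64 : ℕ) : ℤ))
    (B₀ := (N : ℤ) + 1) (B₁ := (N : ℤ) + (N / 8 : ℕ) - 1) Vd.reverse
    (fun f hf => by
      rw [Walk.support_reverse, List.mem_reverse] at hf
      exact ⟨(hVd f hf).1, (hVd f hf).2.1⟩)
    (by omega) (by omega) (by omega) Css hsa hsb
    (fun f hf => by
      obtain ⟨h0, h0', hf'⟩ := hCss f hf
      have h := hCd f (hCs f hf').2.2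
      exact ⟨h0, h0', h.2.2.1, by omega⟩)
  replace huV : u ∈ Vd.support := by rwa [Walk.support_reverse, List.mem_reverse] at huV
  have huCs : u ∈ Cs.support := (hCss u huC).2.2
  -- the attaching walk
  obtain ⟨X₁, hX₁s, hX₁d⟩ := exists_faceWalk_within_support Hd hv₀H hv₁H
  obtain ⟨X₂, hX₂s, hX₂d⟩ := exists_faceWalk_within_support Vd hv₁V huV
  have hGpc : ∀ d ∈ Gp.darts, sepEdge d.fst d.snd ∉ ω :=
    forall_darts_sepEdge_notMem_of_edges G.reverse (forall_darts_reverse_sepEdge_notMem G hGc) Gp hGpe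
  refine ⟨a, b, u, Cs, (Gp.takeUntil v₀ hv₀Gp).append (X₁.append X₂), ⟨ha, hb⟩,
    fun w hw => ?_, hCsc, huCs, fun w hw => ?_, fun d hd => ?_⟩
  · obtain ⟨h0, h0', hw'⟩ := hCs w hw
    have h := hCd w hw'
    exact ⟨abs_le.2 ⟨by omega, by omega⟩, h.2.2.1, by omega⟩
  · rw [Walk.mem_support_append_iff, Walk.mem_support_append_iff] at hw
    rcases hw with hw | hw | hw
    · have h := hGp w (Gp.support_takeUntil_subset_support hv₀Gp hw)
      have h' := hG w (by have := h.2; rwa [Walk.support_reverse, List.mem_reverse] at this)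
      exact attachBound_outT hN ⟨hg'.1, by omega⟩ hg (by omega) (by omega) h.1 (by omega)
    · obtain ⟨h0, h0', h1, h1'⟩ := hHd w (hX₁s w hw)
      exact attachBound_outT hN ⟨hg'.1, by omega⟩ hg h0 h0' h1 (by omega)
    · obtain ⟨h0, h0', h1, h1'⟩ := hVd w (hX₂s w hw)
      exact attachBound_outT hN ⟨hg'.1, by omega⟩ hg (by omega) (by omega) h1 h1'
  · rw [Walk.darts_append, List.mem_append, Walk.darts_append, List.mem_append] at hd
    rcases hd with hd | hd | hd
    · exact closed_takeUntil Gp hv₀Gp hGpc d hd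
    · exact closed_of_within Hd hHdc X₁ hX₁d d hd
    · exact closed_of_within Vd hVdc X₂ hX₂d d hd

/-- **Outer fence of the bottom dual arm from three face crossings** (mirror image of
`exists_outwardFence_T`): `G` ends at the face `g = (g₀, -N-1)`, faces in the rows `[-N-1, Y]`,
`-N + N/16 ≤ Y + 2`; `Hd` crosses `[-N/64, 2·N/64] × [-N, -N + N/16 - 2]` left to right, `Vd` runs in the
face columns `[0, N/64]` from the row `-N + N/16 - 2` down to the row `-N - N/8`, `Cd` crosses
`[-N/64, 2·N/64] × [-N - N/8, -N - 2]` left to right. [cite: Nolin2008, §4.2 Def. 6 and §4.3 proof of Prop. 12 (i) (arXiv 0711.4948)] -/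
theorem exists_outwardFence_B (hN : 64 ≤ N) {Y E : ℤ} (hY : -(N : ℤ) + (N / 16 : ℕ) ≤ Y + 2)
    (hE : 0 ≤ E ∧ E ≤ (N / 64 : ℕ))
    {q g : Site 2} (G : (zdGraph 2).Walk q g) (hq : q 1 = Y) (hg : g 1 + 1 = -(N : ℤ))
    (hG : ∀ f ∈ G.support, 0 ≤ f 0 ∧ f 0 ≤ E ∧ -(N : ℤ) - 1 ≤ f 1 ∧ f 1 ≤ Y)
    (hGc : ∀ d ∈ G.darts, sepEdge d.fst d.snd ∉ ω)
    {xa xb : Site 2} (Hd : (zdGraph 2).Walk xa xb) (hxa : xa 0 = -((N / 64 : ℕ) : ℤ))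
    (hxb : xb 0 = 2 * ((N / 64 : ℕ) : ℤ))
    (hHd : ∀ f ∈ Hd.support, -((N / 64 : ℕ) : ℤ) ≤ f 0 ∧ f 0 ≤ 2 * ((N / 64 : ℕ) : ℤ) ∧
      -(N : ℤ) ≤ f 1 ∧ f 1 + 2 ≤ -(N : ℤ) + (N / 16 : ℕ))
    (hHdc : ∀ d ∈ Hd.darts, sepEdge d.fst d.snd ∉ ω)
    {va vb : Site 2} (Vd : (zdGraph 2).Walk va vb) (hva : va 1 + 2 = -(N : ℤ) + (N / 16 : ℕ))
    (hvb : vb 1 = -(N : ℤ) - (N / 8 : ℕ))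
    (hVd : ∀ f ∈ Vd.support, 0 ≤ f 0 ∧ f 0 ≤ (N / 64 : ℕ) ∧ -(N : ℤ) - (N / 8 : ℕ) ≤ f 1 ∧
      f 1 + 2 ≤ -(N : ℤ) + (N / 16 : ℕ))
    (hVdc : ∀ d ∈ Vd.darts, sepEdge d.fst d.snd ∉ ω)
    {ya yb : Site 2} (Cd : (zdGraph 2).Walk ya yb) (hya : ya 0 = -((N / 64 : ℕ) : ℤ))
    (hyb : yb 0 = 2 * ((N / 64 : ℕ) : ℤ))
    (hCd : ∀ f ∈ Cd.support, -((N / 64 : ℕ) : ℤ) ≤ f 0 ∧ f 0 ≤ 2 * ((N / 64 : ℕ) : ℤ) ∧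
      -(N : ℤ) - (N / 8 : ℕ) ≤ f 1 ∧ f 1 + 2 ≤ -(N : ℤ))
    (hCdc : ∀ d ∈ Cd.darts, sepEdge d.fst d.snd ∉ ω) :
    ∃ (a b u : Site 2) (C : (zdGraph 2).Walk a b) (P : (zdGraph 2).Walk g u),
      (a 0 = g 0 - (N / 64 : ℕ) ∧ b 0 = g 0 + (N / 64 : ℕ)) ∧
      (∀ w ∈ C.support, |w 0 - g 0| ≤ (N / 64 : ℕ) ∧ -((N : ℤ) + 1 + (N / 8 : ℕ)) ≤ w 1 ∧ w 1 + 2 ≤ -(N : ℤ)) ∧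
      (∀ d ∈ C.darts, sepEdge d.fst d.snd ∉ ω) ∧ u ∈ C.support ∧
      (∀ w ∈ P.support, |w 0 - g 0| + 1 ≤ (N / 8 : ℕ) ∧ |w 1 - g 1| + 1 ≤ (N / 8 : ℕ)) ∧
      ∀ d ∈ P.darts, sepEdge d.fst d.snd ∉ ω := by
  classical
  have hg' := hG g G.end_mem_support
  -- the fence crossing
  obtain ⟨a, b, Cs, ha, hb, hCs, hCse⟩ := exists_segment_between 0 Cd (g 0 - (N / 64 : ℕ))
    (g 0 + (N / 64 : ℕ)) (by rw [hya]; omega) (by rw [hyb]; omega) (by omega)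
  have hCsc : ∀ d ∈ Cs.darts, sepEdge d.fst d.snd ∉ ω := forall_darts_sepEdge_notMem_of_edges Cd hCdc Cs hCse
  -- `G` after its last visit to the row `-N + N/16 - 2` meets `Hd`
  obtain ⟨qk, Gp, hqk, hGp, hGpe⟩ := exists_prefix_reach_ge 1 G.reverse (-(N : ℤ) + (N / 16 : ℕ) - 2)
    (by omega) (by rw [hq]; omega)
  obtain ⟨pa, pb, Gs, hpa, hpb, hGs, -⟩ := exists_segment_between 1 Gp (-(N : ℤ))
    (-(N : ℤ) + (N / 16 : ℕ) - 2) (by omega) (by rw [hqk]) (by omega)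
  obtain ⟨v₀, hv₀G, hv₀H⟩ := exists_mem_support_of_hFence (L₀ := 0) (L₁ := E)
    (B := -(N : ℤ)) (B' := -(N : ℤ) + (N / 16 : ℕ) - 2) Hd
    (fun f hf => ⟨(hHd f hf).2.2.1, by have := (hHd f hf).2.2.2; omega⟩) (by rw [hxa]; omega)
    (by rw [hxb]; omega) hE.1 Gs hpa hpb
    (fun f hf => by
      obtain ⟨h1, h1', hf'⟩ := hGs f hf
      have h := hG f (by have := (hGp f hf').2; rwa [Walk.support_reverse, List.mem_reverse] at this)
      exact ⟨h.1, h.2.1, h1, h1'⟩)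
  have hv₀Gp : v₀ ∈ Gp.support := (hGs v₀ hv₀G).2.2
  -- `Vd` reversed, between the rows `-N` and `-N + N/16 - 2`, meets `Hd`
  obtain ⟨ra, rb, Vs, hra, hrb, hVs, -⟩ := exists_segment_between 1 Vd.reverse (-(N : ℤ))
    (-(N : ℤ) + (N / 16 : ℕ) - 2) (by rw [hvb]; omega) (by omega) (by omega)
  obtain ⟨v₁, hv₁V, hv₁H⟩ := exists_mem_support_of_hFence (L₀ := 0) (L₁ := ((N / 64 : ℕ) : ℤ))
    (B := -(N : ℤ)) (B' := -(N : ℤ) + (N / 16 : ℕ) - 2) Hd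
    (fun f hf => ⟨(hHd f hf).2.2.1, by have := (hHd f hf).2.2.2; omega⟩) (by rw [hxa]; omega)
    (by rw [hxb]; omega) (by omega) Vs hra hrb
    (fun f hf => by
      obtain ⟨h1, h1', hf'⟩ := hVs f hf
      rw [Walk.support_reverse, List.mem_reverse] at hf'
      exact ⟨(hVd f hf').1, (hVd f hf').2.1, h1, h1'⟩)
  replace hv₁V : v₁ ∈ Vd.support := by
    have := (hVs v₁ hv₁V).2.2; rwa [Walk.support_reverse, List.mem_reverse] at this
  -- the segment of the fence crossing between the columns `0` and `N/64` meets `Vd`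
  obtain ⟨sa, sb, Css, hsa, hsb, hCss, -⟩ := exists_segment_between 0 Cs 0 ((N / 64 : ℕ) : ℤ)
    (by rw [ha]; omega) (by rw [hb]; omega) (by omega)
  obtain ⟨u, huC, huV⟩ := exists_mem_support_of_vFence (L := 0) (R := ((N / 64 : ℕ) : ℤ))
    (B₀ := -(N : ℤ) - (N / 8 : ℕ)) (B₁ := -(N : ℤ) - 2) Vd.reverse
    (fun f hf => by
      rw [Walk.support_reverse, List.mem_reverse] at hf
      exact ⟨(hVd f hf).1, (hVd f hf).2.1⟩)
    hvb.le (by omega) (by omega) Css hsa hsb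
    (fun f hf => by
      obtain ⟨h0, h0', hf'⟩ := hCss f hf
      have h := hCd f (hCs f hf').2.2
      exact ⟨h0, h0', h.2.2.1, by omega⟩)
  replace huV : u ∈ Vd.support := by rwa [Walk.support_reverse, List.mem_reverse] at huV
  have huCs : u ∈ Cs.support := (hCss u huC).2.2
  -- the attaching walk
  obtain ⟨X₁, hX₁s, hX₁d⟩ := exists_faceWalk_within_support Hd hv₀H hv₁H
  obtain ⟨X₂, hX₂s, hX₂d⟩ := exists_faceWalk_within_support Vd hv₁V huV
  have hGpc : ∀ d ∈ Gp.darts, sepEdge d.fst d.snd ∉ ω :=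
    forall_darts_sepEdge_notMem_of_edges G.reverse (forall_darts_reverse_sepEdge_notMem G hGc) Gp hGpe
  refine ⟨a, b, u, Cs, (Gp.takeUntil v₀ hv₀Gp).append (X₁.append X₂), ⟨ha, hb⟩,
    fun w hw => ?_, hCsc, huCs, fun w hw => ?_, fun d hd => ?_⟩
  · obtain ⟨h0, h0', hw'⟩ := hCs w hw
    have h := hCd w hw'
    exact ⟨abs_le.2 ⟨by omega, by omega⟩, by omega, h.2.2.2⟩
  · rw [Walk.mem_support_append_iff, Walk.mem_support_append_iff] at hw
    rcases hw with hw | hw | hw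
    · have h := hGp w (Gp.support_takeUntil_subset_support hv₀Gp hw)
      have h' := hG w (by have := h.2; rwa [Walk.support_reverse, List.mem_reverse] at this)
      exact attachBound_outB hN ⟨hg'.1, by omega⟩ hg (by omega) (by omega) (by omega) (by omega)
    · obtain ⟨h0, h0', h1, h1'⟩ := hHd w (hX₁s w hw)
      exact attachBound_outB hN ⟨hg'.1, by omega⟩ hg h0 h0' (by omega) h1'
    · obtain ⟨h0, h0', h1, h1'⟩ := hVd w (hX₂s w hw)
      exact attachBound_outB hN ⟨hg'.1, by omega⟩ hg (by omega) (by omega) h1 h1'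
  · rw [Walk.darts_append, List.mem_append, Walk.darts_append, List.mem_append] at hd
    rcases hd with hd | hd | hd
    · exact closed_takeUntil Gp hv₀Gp hGpc d hd
    · exact closed_of_within Hd hHdc X₁ hX₁d d hd
    · exact closed_of_within Vd hVdc X₂ hX₂d d hd

end OutwardFence

/-! ### Dual bodies: a piece of a face walk meeting the two extreme rows only at its ends -/

section DoubleSharp

variable {a b : Site 2}

/-- **Double-sharp piece of a face walk.**  From a face walk from the row `hi` down to the row `lo`
(`lo < hi`) one extracts a face walk from a face of the row `lo` to a face of the row `hi` using only
faces and steps of the original one, all of whose steps start strictly below the row `hi` and have an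
endpoint strictly above the row `lo` (its only faces on the two extreme rows are its two ends).
[folklore] -/
theorem exists_doubleSharp_faceWalk (K : (zdGraph 2).Walk a b) {lo hi : ℤ} (ha : a 1 = hi) (hb : b 1 = lo)
    (hlt : lo < hi) :
    ∃ (q g : Site 2) (Q : (zdGraph 2).Walk q g), q 1 = lo ∧ g 1 = hi ∧
      (∀ f ∈ Q.support, f ∈ K.support) ∧ (∀ e ∈ Q.edges, e ∈ K.edges) ∧
      (∀ d ∈ Q.darts, d.fst 1 + 1 ≤ hi) ∧ ∀ d ∈ Q.darts, lo + 1 ≤ max (d.fst 1) (d.snd 1) := by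
  obtain ⟨q, Kp, hq, hKps, hKpe, hKpd⟩ := exists_prefix_reach_le_sharp 1 K lo (by omega) (by omega)
  obtain ⟨g, Kpp, hg, hKpps, hKppe, hKppd⟩ := exists_prefix_reach_ge_sharp 1 Kp.reverse hi (by omega)
    (by rw [ha])
  refine ⟨q, g, Kpp, hq, hg, fun f hf => ?_, fun e he => ?_, fun d hd => by have := hKppd d hd; omega,
    fun d hd => ?_⟩
  · have := (hKpps f hf).2
    rw [Walk.support_reverse, List.mem_reverse] at this
    exact (hKps f this).2
  · have := hKppe e he
    rw [Walk.edges_reverse, List.mem_reverse] at this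
    exact hKpe e this
  · have he : d.edge ∈ Kp.edges := by
      have : d.edge ∈ Kpp.edges := by rw [Walk.edges]; exact List.mem_map.2 ⟨d, hd, rfl⟩
      have := hKppe _ this
      rwa [Walk.edges_reverse, List.mem_reverse] at this
    rw [Walk.edges] at he
    obtain ⟨d', hd', hdd'⟩ := List.mem_map.1 he
    have h := hKpd d' hd'
    rcases (SimpleGraph.dart_edge_eq_iff d' d).1 hdd' with rfl | rfl
    · exact le_trans (by omega) (le_max_left _ _)
    · rw [SimpleGraph.Dart.symm_toProd, Prod.fst_swap] at h
      exact le_trans (by omega) (le_max_right _ _)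

end DoubleSharp

/-! ### The four fenced arms at one scale -/

section Arms

variable {ω : BondConfig (Site 2)} {m N : ℕ}

/-- **A fenced right arm of `A_{m,N}` from seven crossings** (`64 ≤ m`, `2m ≤ N`): the body is an open
left–right crossing `H` of `[m, N] × [0, m/64]`; the inner fence and attaching walk come from
`exists_inwardFence_R`, the outer ones from `exists_outwardFence_R`. [cite: Nolin2008, §4.3 Prop. 12 (i) and Prop. 13 (arXiv 0711.4948: Prop. 11, Prop. 12)] -/
theorem exists_zdSepOpenArmR_init (hm : 64 ≤ m) (hmN : 2 * m ≤ N)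
    {s z : Site 2} (H : (zdGraph 2).Walk s z) (hs : s 0 = m) (hz : z 0 = N)
    (hH : ∀ v ∈ H.support, (m : ℤ) ≤ v 0 ∧ v 0 ≤ N ∧ 0 ≤ v 1 ∧ v 1 ≤ (m / 64 : ℕ))
    (hHo : ∀ e ∈ H.edges, e ∈ ω)
    {s₀ y₀ : Site 2} (H₀ : (zdGraph 2).Walk s₀ y₀) (hs₀ : s₀ 0 = (m : ℤ) - (m / 8 : ℕ) + 1)
    (hy₀ : y₀ 0 = (m : ℤ) + (m / 16 : ℕ))
    (hH₀ : ∀ v ∈ H₀.support, (m : ℤ) - (m / 8 : ℕ) + 1 ≤ v 0 ∧ v 0 ≤ (m : ℤ) + (m / 16 : ℕ) ∧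
      0 ≤ v 1 ∧ v 1 ≤ (m / 64 : ℕ))
    (hH₀o : ∀ e ∈ H₀.edges, e ∈ ω)
    {p₀ q₀ : Site 2} (V₀ : (zdGraph 2).Walk p₀ q₀) (hp₀ : p₀ 1 = -((m / 64 : ℕ) : ℤ))
    (hq₀ : q₀ 1 = 2 * ((m / 64 : ℕ) : ℤ))
    (hV₀ : ∀ v ∈ V₀.support, (m : ℤ) + 1 ≤ v 0 ∧ v 0 ≤ (m : ℤ) + (m / 16 : ℕ) ∧
      -((m / 64 : ℕ) : ℤ) ≤ v 1 ∧ v 1 ≤ 2 * ((m / 64 : ℕ) : ℤ))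
    (hV₀o : ∀ e ∈ V₀.edges, e ∈ ω)
    {p₁ q₁ : Site 2} (V₁ : (zdGraph 2).Walk p₁ q₁) (hp₁ : p₁ 1 = -((m / 64 : ℕ) : ℤ))
    (hq₁ : q₁ 1 = 2 * ((m / 64 : ℕ) : ℤ))
    (hV₁ : ∀ v ∈ V₁.support, (m : ℤ) - (m / 8 : ℕ) + 1 ≤ v 0 ∧ v 0 + 1 ≤ (m : ℤ) ∧
      -((m / 64 : ℕ) : ℤ) ≤ v 1 ∧ v 1 ≤ 2 * ((m / 64 : ℕ) : ℤ))
    (hV₁o : ∀ e ∈ V₁.edges, e ∈ ω)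
    {s₂ y₂ : Site 2} (G₀ : (zdGraph 2).Walk s₂ y₂) (hs₂ : s₂ 0 = (N : ℤ) - (N / 16 : ℕ))
    (hy₂ : y₂ 0 + 1 = (N : ℤ) + (N / 8 : ℕ))
    (hG₀ : ∀ v ∈ G₀.support, (N : ℤ) - (N / 16 : ℕ) ≤ v 0 ∧ v 0 + 1 ≤ (N : ℤ) + (N / 8 : ℕ) ∧
      0 ≤ v 1 ∧ v 1 ≤ (N / 64 : ℕ))
    (hG₀o : ∀ e ∈ G₀.edges, e ∈ ω)
    {p₂ q₂ : Site 2} (U₀ : (zdGraph 2).Walk p₂ q₂) (hp₂ : p₂ 1 = -((N / 64 : ℕ) : ℤ))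
    (hq₂ : q₂ 1 = 2 * ((N / 64 : ℕ) : ℤ))
    (hU₀ : ∀ v ∈ U₀.support, (N : ℤ) - (N / 16 : ℕ) ≤ v 0 ∧ v 0 + 1 ≤ N ∧
      -((N / 64 : ℕ) : ℤ) ≤ v 1 ∧ v 1 ≤ 2 * ((N / 64 : ℕ) : ℤ))
    (hU₀o : ∀ e ∈ U₀.edges, e ∈ ω)
    {p₃ q₃ : Site 2} (U : (zdGraph 2).Walk p₃ q₃) (hp₃ : p₃ 1 = -((N / 64 : ℕ) : ℤ))
    (hq₃ : q₃ 1 = 2 * ((N / 64 : ℕ) : ℤ))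
    (hU : ∀ v ∈ U.support, (N : ℤ) + 1 ≤ v 0 ∧ v 0 + 1 ≤ (N : ℤ) + (N / 8 : ℕ) ∧
      -((N / 64 : ℕ) : ℤ) ≤ v 1 ∧ v 1 ≤ 2 * ((N / 64 : ℕ) : ℤ))
    (hUo : ∀ e ∈ U.edges, e ∈ ω) :
    Nonempty (ZdSepOpenArmR ω m N 0 (m / 64 : ℕ) 0 (N / 64 : ℕ)) := by
  have hs' := hH s H.start_mem_support
  have hz' := hH z H.end_mem_support
  have hm1 : 1 ≤ m := by omega
  have hdiv : m / 64 ≤ N / 64 := Nat.div_le_div_right (by omega)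
  obtain ⟨a', b', u', V', P', hab', hV', hV'o, hu', hP', hP'o⟩ := exists_inwardFence_R hm (X := (N : ℤ))
    (by omega) H hs hz hH hHo H₀ hs₀ hy₀ hH₀ hH₀o V₀ hp₀ hq₀ hV₀ hV₀o V₁ hp₁ hq₁ hV₁ hV₁o
  obtain ⟨a, b, u, V, P, hab, hV, hVo, hu, hP, hPo⟩ := exists_outwardFence_R (N := N) (by omega) (X := (m : ℤ))
    (by omega) H hs hz (fun v hv => by obtain ⟨h0, h0', h1, h1'⟩ := hH v hv; exact ⟨h0, h0', h1, by omega⟩) hHo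
    G₀ hs₂ hy₂ hG₀ hG₀o U₀ hp₂ hq₂ hU₀ hU₀o U hp₃ hq₃ hU hUo
  exact ⟨ZdSepOpenArmR.ofPieces H ⟨hs, hs'.2.2.1, hs'.2.2.2⟩ ⟨hz, hz'.2.2.1, by omega⟩
    (fun v hv => by
      obtain ⟨h0, h0', h1, h1'⟩ := hH v hv
      exact mem_sqAnnulus_of_bounds hm1 (by omega) h0' (by omega) (by omega) (Or.inl h0))
    hHo V P hab hV hVo hu hP hPo V' P' hab' hV' hV'o hu' hP' hP'o⟩

/-- **A fenced left arm of `A_{m,N}` from seven crossings** (mirror image): the body `H` crosses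
`[-N, -m] × [0, m/64]` and is given from its RIGHT column `-m`. [cite: Nolin2008, §4.3 Prop. 12 (i) and Prop. 13 (arXiv 0711.4948: Prop. 11, Prop. 12)] -/
theorem exists_zdSepOpenArmL_init (hm : 64 ≤ m) (hmN : 2 * m ≤ N)
    {s z : Site 2} (H : (zdGraph 2).Walk s z) (hs : s 0 = -(m : ℤ)) (hz : z 0 = -(N : ℤ))
    (hH : ∀ v ∈ H.support, -(N : ℤ) ≤ v 0 ∧ v 0 ≤ -(m : ℤ) ∧ 0 ≤ v 1 ∧ v 1 ≤ (m / 64 : ℕ))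
    (hHo : ∀ e ∈ H.edges, e ∈ ω)
    {s₀ y₀ : Site 2} (H₀ : (zdGraph 2).Walk s₀ y₀) (hs₀ : s₀ 0 = -(m : ℤ) + (m / 8 : ℕ) - 1)
    (hy₀ : y₀ 0 = -((m : ℤ) + (m / 16 : ℕ)))
    (hH₀ : ∀ v ∈ H₀.support, -((m : ℤ) + (m / 16 : ℕ)) ≤ v 0 ∧ v 0 ≤ -(m : ℤ) + (m / 8 : ℕ) - 1 ∧
      0 ≤ v 1 ∧ v 1 ≤ (m / 64 : ℕ))
    (hH₀o : ∀ e ∈ H₀.edges, e ∈ ω)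
    {p₀ q₀ : Site 2} (V₀ : (zdGraph 2).Walk p₀ q₀) (hp₀ : p₀ 1 = -((m / 64 : ℕ) : ℤ))
    (hq₀ : q₀ 1 = 2 * ((m / 64 : ℕ) : ℤ))
    (hV₀ : ∀ v ∈ V₀.support, -((m : ℤ) + (m / 16 : ℕ)) ≤ v 0 ∧ v 0 + 1 ≤ -(m : ℤ) ∧
      -((m / 64 : ℕ) : ℤ) ≤ v 1 ∧ v 1 ≤ 2 * ((m / 64 : ℕ) : ℤ))
    (hV₀o : ∀ e ∈ V₀.edges, e ∈ ω)
    {p₁ q₁ : Site 2} (V₁ : (zdGraph 2).Walk p₁ q₁) (hp₁ : p₁ 1 = -((m / 64 : ℕ) : ℤ))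
    (hq₁ : q₁ 1 = 2 * ((m / 64 : ℕ) : ℤ))
    (hV₁ : ∀ v ∈ V₁.support, -(m : ℤ) + 1 ≤ v 0 ∧ v 0 ≤ -(m : ℤ) + (m / 8 : ℕ) - 1 ∧
      -((m / 64 : ℕ) : ℤ) ≤ v 1 ∧ v 1 ≤ 2 * ((m / 64 : ℕ) : ℤ))
    (hV₁o : ∀ e ∈ V₁.edges, e ∈ ω)
    {s₂ y₂ : Site 2} (G₀ : (zdGraph 2).Walk s₂ y₂) (hs₂ : s₂ 0 = -(N : ℤ) + (N / 16 : ℕ))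
    (hy₂ : y₂ 0 = -(N : ℤ) - (N / 8 : ℕ) + 1)
    (hG₀ : ∀ v ∈ G₀.support, -(N : ℤ) - (N / 8 : ℕ) + 1 ≤ v 0 ∧ v 0 ≤ -(N : ℤ) + (N / 16 : ℕ) ∧
      0 ≤ v 1 ∧ v 1 ≤ (N / 64 : ℕ))
    (hG₀o : ∀ e ∈ G₀.edges, e ∈ ω)
    {p₂ q₂ : Site 2} (U₀ : (zdGraph 2).Walk p₂ q₂) (hp₂ : p₂ 1 = -((N / 64 : ℕ) : ℤ))
    (hq₂ : q₂ 1 = 2 * ((N / 64 : ℕ) : ℤ))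
    (hU₀ : ∀ v ∈ U₀.support, -(N : ℤ) + 1 ≤ v 0 ∧ v 0 ≤ -(N : ℤ) + (N / 16 : ℕ) ∧
      -((N / 64 : ℕ) : ℤ) ≤ v 1 ∧ v 1 ≤ 2 * ((N / 64 : ℕ) : ℤ))
    (hU₀o : ∀ e ∈ U₀.edges, e ∈ ω)
    {p₃ q₃ : Site 2} (U : (zdGraph 2).Walk p₃ q₃) (hp₃ : p₃ 1 = -((N / 64 : ℕ) : ℤ))
    (hq₃ : q₃ 1 = 2 * ((N / 64 : ℕ) : ℤ))
    (hU : ∀ v ∈ U.support, -(N : ℤ) - (N / 8 : ℕ) + 1 ≤ v 0 ∧ v 0 + 1 ≤ -(N : ℤ) ∧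
      -((N / 64 : ℕ) : ℤ) ≤ v 1 ∧ v 1 ≤ 2 * ((N / 64 : ℕ) : ℤ))
    (hUo : ∀ e ∈ U.edges, e ∈ ω) :
    Nonempty (ZdSepOpenArmL ω m N 0 (m / 64 : ℕ) 0 (N / 64 : ℕ)) := by
  have hs' := hH s H.start_mem_support
  have hz' := hH z H.end_mem_support
  have hm1 : 1 ≤ m := by omega
  have hdiv : m / 64 ≤ N / 64 := Nat.div_le_div_right (by omega)
  obtain ⟨a', b', u', V', P', hab', hV', hV'o, hu', hP', hP'o⟩ := exists_inwardFence_L hm (X := -(N : ℤ))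
    (by omega) H hs hz hH hHo H₀ hs₀ hy₀ hH₀ hH₀o V₀ hp₀ hq₀ hV₀ hV₀o V₁ hp₁ hq₁ hV₁ hV₁o
  obtain ⟨a, b, u, V, P, hab, hV, hVo, hu, hP, hPo⟩ := exists_outwardFence_L (N := N) (by omega) (X := -(m : ℤ))
    (by omega) H hs hz (fun v hv => by obtain ⟨h0, h0', h1, h1'⟩ := hH v hv; exact ⟨h0, h0', h1, by omega⟩) hHo
    G₀ hs₂ hy₂ hG₀ hG₀o U₀ hp₂ hq₂ hU₀ hU₀o U hp₃ hq₃ hU hUo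
  exact ⟨ZdSepOpenArmL.ofPieces H ⟨hs, hs'.2.2.1, hs'.2.2.2⟩ ⟨hz, hz'.2.2.1, by omega⟩
    (fun v hv => by
      obtain ⟨h0, h0', h1, h1'⟩ := hH v hv
      exact mem_sqAnnulus_of_bounds hm1 h0 (by omega) (by omega) (by omega) (Or.inr (Or.inl h0')))
    hHo V P hab hV hVo hu hP hPo V' P' hab' hV' hV'o hu' hP' hP'o⟩

/-- **A fenced top dual arm of `A_{m,N}` from seven face crossings** (`64 ≤ m`, `2m ≤ N`): the body
is the double-sharp piece (`exists_doubleSharp_faceWalk`) of a closed-dual face walk `K` of the face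
columns `[0, m/64]` from the row `N` down to the row `m - 1`; inner fence from
`exists_inwardFence_T`, outer fence from `exists_outwardFence_T`. [cite: Nolin2008, §4.3 Prop. 12 (i) and Prop. 13 (arXiv 0711.4948: Prop. 11, Prop. 12)] -/
theorem exists_zdSepDualArmT_init (hm : 64 ≤ m) (hmN : 2 * m ≤ N)
    {ka kb : Site 2} (K : (zdGraph 2).Walk ka kb) (hka : ka 1 = N) (hkb : kb 1 + 1 = m)
    (hK : ∀ f ∈ K.support, 0 ≤ f 0 ∧ f 0 ≤ (m / 64 : ℕ) ∧ (m : ℤ) - 1 ≤ f 1 ∧ f 1 ≤ N)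
    (hKc : ∀ d ∈ K.darts, sepEdge d.fst d.snd ∉ ω)
    {xa xb : Site 2} (Hd : (zdGraph 2).Walk xa xb) (hxa : xa 0 = -((m / 64 : ℕ) : ℤ))
    (hxb : xb 0 = 2 * ((m / 64 : ℕ) : ℤ))
    (hHd : ∀ f ∈ Hd.support, -((m / 64 : ℕ) : ℤ) ≤ f 0 ∧ f 0 ≤ 2 * ((m / 64 : ℕ) : ℤ) ∧
      (m : ℤ) ≤ f 1 ∧ f 1 + 1 ≤ (m : ℤ) + (m / 16 : ℕ))
    (hHdc : ∀ d ∈ Hd.darts, sepEdge d.fst d.snd ∉ ω)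
    {va vb : Site 2} (Vd : (zdGraph 2).Walk va vb) (hva : va 1 + 1 = (m : ℤ) + (m / 16 : ℕ))
    (hvb : vb 1 = (m : ℤ) - (m / 8 : ℕ))
    (hVd : ∀ f ∈ Vd.support, 0 ≤ f 0 ∧ f 0 ≤ (m / 64 : ℕ) ∧ (m : ℤ) - (m / 8 : ℕ) ≤ f 1 ∧
      f 1 + 1 ≤ (m : ℤ) + (m / 16 : ℕ))
    (hVdc : ∀ d ∈ Vd.darts, sepEdge d.fst d.snd ∉ ω)
    {ya yb : Site 2} (Cd : (zdGraph 2).Walk ya yb) (hya : ya 0 = -((m / 64 : ℕ) : ℤ))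
    (hyb : yb 0 = 2 * ((m / 64 : ℕ) : ℤ))
    (hCd : ∀ f ∈ Cd.support, -((m / 64 : ℕ) : ℤ) ≤ f 0 ∧ f 0 ≤ 2 * ((m / 64 : ℕ) : ℤ) ∧
      (m : ℤ) - (m / 8 : ℕ) ≤ f 1 ∧ f 1 + 2 ≤ (m : ℤ))
    (hCdc : ∀ d ∈ Cd.darts, sepEdge d.fst d.snd ∉ ω)
    {xa' xb' : Site 2} (Hd' : (zdGraph 2).Walk xa' xb') (hxa' : xa' 0 = -((N / 64 : ℕ) : ℤ))
    (hxb' : xb' 0 = 2 * ((N / 64 : ℕ) : ℤ))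
    (hHd' : ∀ f ∈ Hd'.support, -((N / 64 : ℕ) : ℤ) ≤ f 0 ∧ f 0 ≤ 2 * ((N / 64 : ℕ) : ℤ) ∧
      (N : ℤ) - (N / 16 : ℕ) + 1 ≤ f 1 ∧ f 1 + 1 ≤ N)
    (hHd'c : ∀ d ∈ Hd'.darts, sepEdge d.fst d.snd ∉ ω)
    {va' vb' : Site 2} (Vd' : (zdGraph 2).Walk va' vb') (hva' : va' 1 + 1 = (N : ℤ) + (N / 8 : ℕ))
    (hvb' : vb' 1 = (N : ℤ) - (N / 16 : ℕ) + 1)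
    (hVd' : ∀ f ∈ Vd'.support, 0 ≤ f 0 ∧ f 0 ≤ (N / 64 : ℕ) ∧ (N : ℤ) - (N / 16 : ℕ) + 1 ≤ f 1 ∧
      f 1 + 1 ≤ (N : ℤ) + (N / 8 : ℕ))
    (hVd'c : ∀ d ∈ Vd'.darts, sepEdge d.fst d.snd ∉ ω)
    {ya' yb' : Site 2} (Cd' : (zdGraph 2).Walk ya' yb') (hya' : ya' 0 = -((N / 64 : ℕ) : ℤ))
    (hyb' : yb' 0 = 2 * ((N / 64 : ℕ) : ℤ))
    (hCd' : ∀ f ∈ Cd'.support, -((N / 64 : ℕ) : ℤ) ≤ f 0 ∧ f 0 ≤ 2 * ((N / 64 : ℕ) : ℤ) ∧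
      (N : ℤ) + 1 ≤ f 1 ∧ f 1 + 1 ≤ (N : ℤ) + (N / 8 : ℕ))
    (hCd'c : ∀ d ∈ Cd'.darts, sepEdge d.fst d.snd ∉ ω) :
    Nonempty (ZdSepDualArmT ω m N 0 (m / 64 : ℕ) 0 (N / 64 : ℕ)) := by
  have hm1 : 1 ≤ m := by omega
  have hdiv : m / 64 ≤ N / 64 := Nat.div_le_div_right (by omega)
  obtain ⟨q, g, Q, hq, hg, hQs, hQe, hQtop, hQbot⟩ := exists_doubleSharp_faceWalk K (lo := (m : ℤ) - 1)
    (hi := (N : ℤ)) hka (by omega) (by omega)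
  have hQb : ∀ f ∈ Q.support, 0 ≤ f 0 ∧ f 0 ≤ (m / 64 : ℕ) ∧ (m : ℤ) - 1 ≤ f 1 ∧ f 1 ≤ N :=
    fun f hf => hK f (hQs f hf)
  have hQc : ∀ d ∈ Q.darts, sepEdge d.fst d.snd ∉ ω := forall_darts_sepEdge_notMem_of_edges K hKc Q hQe
  have hq' := hQb q Q.start_mem_support
  have hg' := hQb g Q.end_mem_support
  have hQa : ∀ d ∈ Q.darts, ∀ v ∈ sepEdge d.fst d.snd, v ∈ sqAnnulus m N := by
    intro d hd v hv
    have h1 := hQb _ (Q.dart_fst_mem_support_of_mem_darts hd)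
    have h2 := hQb _ (Q.dart_snd_mem_support_of_mem_darts hd)
    obtain ⟨⟨c0, c0'⟩, ⟨c1, -⟩⟩ := sepEdge_apply_le hv
    have hv0 : 0 ≤ v 0 ∧ v 0 ≤ (m / 64 : ℕ) + 1 := by
      rcases le_total (d.fst 0) (d.snd 0) with h | h
      · rw [max_eq_right h] at c0 c0'; exact ⟨by omega, by omega⟩
      · rw [max_eq_left h] at c0 c0'; exact ⟨by omega, by omega⟩
    have hv1 : (m : ℤ) ≤ v 1 := le_trans (by have := hQbot d hd; omega) c1
    have hv1' : v 1 ≤ N := by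
      have hv' : v ∈ sepEdge d.snd d.fst := by rwa [sepEdge_comm]
      exact sepEdge_apply_one_le_of_step d.adj.symm hv' (hQtop d hd)
    exact mem_sqAnnulus_of_bounds hm1 (by omega) (by omega) (by omega) hv1' (Or.inr (Or.inr (Or.inl hv1)))
  obtain ⟨a', b', u', C', P', hab', hC', hC'c, hu', hP', hP'c⟩ := exists_inwardFence_T hm (Y := (N : ℤ))
    (by omega) Q (by omega) hg hQb hQc Hd hxa hxb hHd hHdc Vd hva hvb hVd hVdc Cd hya hyb hCd hCdc
  obtain ⟨a, b, u, C, P, hab, hC, hCc, hu, hP, hPc⟩ := exists_outwardFence_T (N := N) (by omega)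
    (Y := (m : ℤ) - 1) (E := ((m / 64 : ℕ) : ℤ)) (by omega) ⟨by omega, by omega⟩ Q hq hg hQb hQc
    Hd' hxa' hxb' hHd' hHd'c Vd' hva' hvb' hVd' hVd'c Cd' hya' hyb' hCd' hCd'c
  exact ⟨ZdSepDualArmT.ofPieces Q ⟨by omega, hq'.1, hq'.2.1⟩ ⟨hg, hg'.1, by omega⟩ hQc hQa
    C P hab hC hCc hu hP hPc C' P' hab' hC' hC'c hu' hP' hP'c⟩

/-- **A fenced bottom dual arm of `A_{m,N}` from seven face crossings** (mirror image): `K` runs in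
the face columns `[0, m/64]` from the row `-m` down to the row `-N - 1`; the body is the REVERSE of its
double-sharp piece. [cite: Nolin2008, §4.3 Prop. 12 (i) and Prop. 13 (arXiv 0711.4948: Prop. 11, Prop. 12)] -/
theorem exists_zdSepDualArmB_init (hm : 64 ≤ m) (hmN : 2 * m ≤ N)
    {ka kb : Site 2} (K : (zdGraph 2).Walk ka kb) (hka : ka 1 = -(m : ℤ)) (hkb : kb 1 + 1 = -(N : ℤ))
    (hK : ∀ f ∈ K.support, 0 ≤ f 0 ∧ f 0 ≤ (m / 64 : ℕ) ∧ -(N : ℤ) - 1 ≤ f 1 ∧ f 1 ≤ -(m : ℤ))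
    (hKc : ∀ d ∈ K.darts, sepEdge d.fst d.snd ∉ ω)
    {xa xb : Site 2} (Hd : (zdGraph 2).Walk xa xb) (hxa : xa 0 = -((m / 64 : ℕ) : ℤ))
    (hxb : xb 0 = 2 * ((m / 64 : ℕ) : ℤ))
    (hHd : ∀ f ∈ Hd.support, -((m / 64 : ℕ) : ℤ) ≤ f 0 ∧ f 0 ≤ 2 * ((m / 64 : ℕ) : ℤ) ∧
      -(m : ℤ) - (m / 16 : ℕ) + 1 ≤ f 1 ∧ f 1 + 1 ≤ -(m : ℤ))
    (hHdc : ∀ d ∈ Hd.darts, sepEdge d.fst d.snd ∉ ω)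
    {va vb : Site 2} (Vd : (zdGraph 2).Walk va vb) (hva : va 1 + 1 = -(m : ℤ) + (m / 8 : ℕ))
    (hvb : vb 1 = -(m : ℤ) - (m / 16 : ℕ) + 1)
    (hVd : ∀ f ∈ Vd.support, 0 ≤ f 0 ∧ f 0 ≤ (m / 64 : ℕ) ∧ -(m : ℤ) - (m / 16 : ℕ) + 1 ≤ f 1 ∧
      f 1 + 1 ≤ -(m : ℤ) + (m / 8 : ℕ))
    (hVdc : ∀ d ∈ Vd.darts, sepEdge d.fst d.snd ∉ ω)
    {ya yb : Site 2} (Cd : (zdGraph 2).Walk ya yb) (hya : ya 0 = -((m / 64 : ℕ) : ℤ))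
    (hyb : yb 0 = 2 * ((m / 64 : ℕ) : ℤ))
    (hCd : ∀ f ∈ Cd.support, -((m / 64 : ℕ) : ℤ) ≤ f 0 ∧ f 0 ≤ 2 * ((m / 64 : ℕ) : ℤ) ∧
      -(m : ℤ) + 1 ≤ f 1 ∧ f 1 + 1 ≤ -(m : ℤ) + (m / 8 : ℕ))
    (hCdc : ∀ d ∈ Cd.darts, sepEdge d.fst d.snd ∉ ω)
    {xa' xb' : Site 2} (Hd' : (zdGraph 2).Walk xa' xb') (hxa' : xa' 0 = -((N / 64 : ℕ) : ℤ))
    (hxb' : xb' 0 = 2 * ((N / 64 : ℕ) : ℤ))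
    (hHd' : ∀ f ∈ Hd'.support, -((N / 64 : ℕ) : ℤ) ≤ f 0 ∧ f 0 ≤ 2 * ((N / 64 : ℕ) : ℤ) ∧
      -(N : ℤ) ≤ f 1 ∧ f 1 + 2 ≤ -(N : ℤ) + (N / 16 : ℕ))
    (hHd'c : ∀ d ∈ Hd'.darts, sepEdge d.fst d.snd ∉ ω)
    {va' vb' : Site 2} (Vd' : (zdGraph 2).Walk va' vb') (hva' : va' 1 + 2 = -(N : ℤ) + (N / 16 : ℕ))
    (hvb' : vb' 1 = -(N : ℤ) - (N / 8 : ℕ))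
    (hVd' : ∀ f ∈ Vd'.support, 0 ≤ f 0 ∧ f 0 ≤ (N / 64 : ℕ) ∧ -(N : ℤ) - (N / 8 : ℕ) ≤ f 1 ∧
      f 1 + 2 ≤ -(N : ℤ) + (N / 16 : ℕ))
    (hVd'c : ∀ d ∈ Vd'.darts, sepEdge d.fst d.snd ∉ ω)
    {ya' yb' : Site 2} (Cd' : (zdGraph 2).Walk ya' yb') (hya' : ya' 0 = -((N / 64 : ℕ) : ℤ))
    (hyb' : yb' 0 = 2 * ((N / 64 : ℕ) : ℤ))
    (hCd' : ∀ f ∈ Cd'.support, -((N / 64 : ℕ) : ℤ) ≤ f 0 ∧ f 0 ≤ 2 * ((N / 64 : ℕ) : ℤ) ∧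
      -(N : ℤ) - (N / 8 : ℕ) ≤ f 1 ∧ f 1 + 2 ≤ -(N : ℤ))
    (hCd'c : ∀ d ∈ Cd'.darts, sepEdge d.fst d.snd ∉ ω) :
    Nonempty (ZdSepDualArmB ω m N 0 (m / 64 : ℕ) 0 (N / 64 : ℕ)) := by
  have hm1 : 1 ≤ m := by omega
  have hdiv : m / 64 ≤ N / 64 := Nat.div_le_div_right (by omega)
  -- the double-sharp piece runs from the row `-N-1` up to the row `-m`; the body is its reverse
  obtain ⟨g, f, Q, hg, hf, hQs, hQe, hQtop, hQbot⟩ := exists_doubleSharp_faceWalk K (lo := -(N : ℤ) - 1)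
    (hi := -(m : ℤ)) hka (by omega) (by omega)
  have hQb : ∀ w ∈ Q.reverse.support, 0 ≤ w 0 ∧ w 0 ≤ (m / 64 : ℕ) ∧ -(N : ℤ) - 1 ≤ w 1 ∧ w 1 ≤ -(m : ℤ) := by
    intro w hw
    rw [Walk.support_reverse, List.mem_reverse] at hw
    exact hK w (hQs w hw)
  have hQc : ∀ d ∈ Q.reverse.darts, sepEdge d.fst d.snd ∉ ω :=
    forall_darts_reverse_sepEdge_notMem Q (forall_darts_sepEdge_notMem_of_edges K hKc Q hQe)
  have hf' := hQb f Q.reverse.start_mem_support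
  have hg' := hQb g Q.reverse.end_mem_support
  have hQa : ∀ d ∈ Q.reverse.darts, ∀ v ∈ sepEdge d.fst d.snd, v ∈ sqAnnulus m N := by
    intro d hd v hv
    rw [Walk.darts_reverse, List.mem_reverse, List.mem_map] at hd
    obtain ⟨d', hd', rfl⟩ := hd
    have h1 := hK _ (hQs _ (Q.dart_fst_mem_support_of_mem_darts hd'))
    have h2 := hK _ (hQs _ (Q.dart_snd_mem_support_of_mem_darts hd'))
    have hv' : v ∈ sepEdge d'.fst d'.snd := by rwa [sepEdge_dart_symm] at hv
    obtain ⟨⟨c0, c0'⟩, ⟨c1, -⟩⟩ := sepEdge_apply_le hv'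
    have hv0 : 0 ≤ v 0 ∧ v 0 ≤ (m / 64 : ℕ) + 1 := by
      rcases le_total (d'.fst 0) (d'.snd 0) with h | h
      · rw [max_eq_right h] at c0 c0'; exact ⟨by omega, by omega⟩
      · rw [max_eq_left h] at c0 c0'; exact ⟨by omega, by omega⟩
    have hv1 : -(N : ℤ) ≤ v 1 := le_trans (by have := hQbot d' hd'; omega) c1
    have hv1' : v 1 ≤ -(m : ℤ) := by
      have hv'' : v ∈ sepEdge d'.snd d'.fst := by rwa [sepEdge_comm]
      exact sepEdge_apply_one_le_of_step d'.adj.symm hv'' (hQtop d' hd')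
    exact mem_sqAnnulus_of_bounds hm1 (by omega) (by omega) hv1 (by omega) (Or.inr (Or.inr (Or.inr hv1')))
  obtain ⟨a', b', u', C', P', hab', hC', hC'c, hu', hP', hP'c⟩ := exists_inwardFence_B hm (Y := -(N : ℤ) - 1)
    (by omega) Q.reverse hf (by omega) hQb hQc Hd hxa hxb hHd hHdc Vd hva hvb hVd hVdc Cd hya hyb hCd hCdc
  obtain ⟨a, b, u, C, P, hab, hC, hCc, hu, hP, hPc⟩ := exists_outwardFence_B (N := N) (by omega)
    (Y := -(m : ℤ)) (E := ((m / 64 : ℕ) : ℤ)) (by omega) ⟨by omega, by omega⟩ Q.reverse hf (by omega) hQb hQc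
    Hd' hxa' hxb' hHd' hHd'c Vd' hva' hvb' hVd' hVd'c Cd' hya' hyb' hCd' hCd'c
  exact ⟨ZdSepDualArmB.ofPieces Q.reverse ⟨hf, hf'.1, hf'.2.1⟩ ⟨by omega, hg'.1, by omega⟩ hQc hQa
    C P hab hC hCc hu hP hPc C' P' hab' hC' hC'c hu' hP' hP'c⟩

end Arms

/-! ### The twenty-eight events and the inclusion -/

section Events

/-- **The fourteen open events** building the two fenced open arms of `zdFourArmSep m N` at one
scale: for the right arm the body corridor `[m, N] × [0, m/64]`, the three inner crossings (as in
`inwardOpenEvents` with `m' = m`) and the three outer crossings `[N - N/16, N + N/8 - 1] × [0, N/64]`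
(left–right), `[N - N/16, N - 1] × [-N/64, 2·N/64]` and `[N + 1, N + N/8 - 1] × [-N/64, 2·N/64]`
(top–bottom); mirror images for the left arm. [cite: Nolin2008, §4.3 Prop. 12 (i), Prop. 13 (arXiv 0711.4948: Prop. 11, Prop. 12)] -/
def initOpenEvents (m N : ℕ) : Set (BondConfig (Site 2)) :=
  (lrCrossingAt ![(m : ℤ), 0] (N - m) (m / 64) ∩
      lrCrossingAt ![(m : ℤ) - (m / 8 : ℕ) + 1, 0] (m / 8 - 1 + m / 16) (m / 64) ∩
      (tbCrossingAt' ![(m : ℤ) + 1, -((m / 64 : ℕ) : ℤ)] (m / 16 - 1) (3 * (m / 64)) ∩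
        tbCrossingAt' ![(m : ℤ) - (m / 8 : ℕ) + 1, -((m / 64 : ℕ) : ℤ)] (m / 8 - 2) (3 * (m / 64))) ∩
    (lrCrossingAt ![(N : ℤ) - (N / 16 : ℕ), 0] (N / 16 + N / 8 - 1) (N / 64) ∩
      (tbCrossingAt' ![(N : ℤ) - (N / 16 : ℕ), -((N / 64 : ℕ) : ℤ)] (N / 16 - 1) (3 * (N / 64)) ∩
        tbCrossingAt' ![(N : ℤ) + 1, -((N / 64 : ℕ) : ℤ)] (N / 8 - 2) (3 * (N / 64))))) ∩
  (lrCrossingAt ![-(N : ℤ), 0] (N - m) (m / 64) ∩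
      lrCrossingAt ![-((m : ℤ) + (m / 16 : ℕ)), 0] (m / 8 - 1 + m / 16) (m / 64) ∩
      (tbCrossingAt' ![-((m : ℤ) + (m / 16 : ℕ)), -((m / 64 : ℕ) : ℤ)] (m / 16 - 1) (3 * (m / 64)) ∩
        tbCrossingAt' ![-(m : ℤ) + 1, -((m / 64 : ℕ) : ℤ)] (m / 8 - 2) (3 * (m / 64))) ∩
    (lrCrossingAt ![-(N : ℤ) - (N / 8 : ℕ) + 1, 0] (N / 16 + N / 8 - 1) (N / 64) ∩
      (tbCrossingAt' ![-(N : ℤ) + 1, -((N / 64 : ℕ) : ℤ)] (N / 16 - 1) (3 * (N / 64)) ∩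
        tbCrossingAt' ![-(N : ℤ) - (N / 8 : ℕ) + 1, -((N / 64 : ℕ) : ℤ)] (N / 8 - 2) (3 * (N / 64)))))

/-- **The fourteen closed-dual events** building the two fenced dual arms of `zdFourArmSep m N` at
one scale: for the top dual arm the body (face columns `[0, m/64]`, face rows `[m-1, N]`), the three
inner face crossings (as in `inwardDualEvents` with `m' = m`) and the three outer face crossings
(`[-N/64, 2·N/64] × [N - N/16 + 1, N - 1]` left–right, columns `[0, N/64]` × rows
`[N - N/16 + 1, N + N/8 - 1]` top–bottom, `[-N/64, 2·N/64] × [N + 1, N + N/8 - 1]` left–right); mirror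
images for the bottom dual arm. [cite: Nolin2008, §4.3 Prop. 12 (i), Prop. 13 (arXiv 0711.4948: Prop. 11, Prop. 12)] -/
def initDualEvents (m N : ℕ) : Set (BondConfig (Site 2)) :=
  (dualFaceCrossing ![0, (m : ℤ)] (m / 64 + 1) (N - m) ∩
      dualLRFaceCrossing ![-((m / 64 : ℕ) : ℤ), (m : ℤ)] (3 * (m / 64)) (m / 16 - 1) ∩
      (dualFaceCrossing ![0, (m : ℤ) - (m / 8 : ℕ) + 1] (m / 64 + 1) (m / 16 + m / 8 - 2) ∩
        dualLRFaceCrossing ![-((m / 64 : ℕ) : ℤ), (m : ℤ) - (m / 8 : ℕ)] (3 * (m / 64)) (m / 8 - 2)) ∩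
    (dualLRFaceCrossing ![-((N / 64 : ℕ) : ℤ), (N : ℤ) - (N / 16 : ℕ) + 1] (3 * (N / 64)) (N / 16 - 2) ∩
      (dualFaceCrossing ![0, (N : ℤ) - (N / 16 : ℕ) + 2] (N / 64 + 1) (N / 16 + N / 8 - 3) ∩
        dualLRFaceCrossing ![-((N / 64 : ℕ) : ℤ), (N : ℤ) + 1] (3 * (N / 64)) (N / 8 - 2)))) ∩
  (dualFaceCrossing ![0, -(N : ℤ)] (m / 64 + 1) (N - m) ∩
      dualLRFaceCrossing ![-((m / 64 : ℕ) : ℤ), -(m : ℤ) - (m / 16 : ℕ) + 1] (3 * (m / 64)) (m / 16 - 2) ∩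
      (dualFaceCrossing ![0, -(m : ℤ) - (m / 16 : ℕ) + 2] (m / 64 + 1) (m / 16 + m / 8 - 3) ∩
        dualLRFaceCrossing ![-((m / 64 : ℕ) : ℤ), -(m : ℤ) + 1] (3 * (m / 64)) (m / 8 - 2)) ∩
    (dualLRFaceCrossing ![-((N / 64 : ℕ) : ℤ), -(N : ℤ)] (3 * (N / 64)) (N / 16 - 2) ∩
      (dualFaceCrossing ![0, -(N : ℤ) - (N / 8 : ℕ) + 1] (N / 64 + 1) (N / 16 + N / 8 - 3) ∩
        dualLRFaceCrossing ![-((N / 64 : ℕ) : ℤ), -(N : ℤ) - (N / 8 : ℕ)] (3 * (N / 64)) (N / 8 - 2))))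

/-- **Positivity at bounded ratio, deterministic half.**  On a lattice configuration the twenty-eight
events give the well-separated event: `initOpenEvents m N ∩ initDualEvents m N ⊆ zdFourArmSep m N`
(`64 ≤ m`, `2m ≤ N`). [cite: Nolin2008, §4.3 Prop. 13, lower bound (arXiv 0711.4948: Prop. 12)] [cite: KestenScalingCMP1987, §2 Lemma 5] -/
theorem mem_zdFourArmSep_of_mem_init {ω : BondConfig (Site 2)} (hω : ω ⊆ (zdGraph 2).edgeSet)
    {m N : ℕ} (hm : 64 ≤ m) (hmN : 2 * m ≤ N)
    (h : ω ∈ initOpenEvents m N ∩ initDualEvents m N) : ω ∈ zdFourArmSep m N := by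
  obtain ⟨⟨⟨⟨⟨hH, hH₀⟩, ⟨hV₀, hV₁⟩⟩, ⟨hG₀, ⟨hU₀, hU⟩⟩⟩, ⟨⟨⟨hHL, hH₀L⟩, ⟨hV₀L, hV₁L⟩⟩, ⟨hG₀L, ⟨hU₀L, hUL⟩⟩⟩⟩,
    ⟨⟨⟨⟨hK, hHd⟩, ⟨hVd, hCd⟩⟩, ⟨hHd', ⟨hVd', hCd'⟩⟩⟩, ⟨⟨⟨hKB, hHdB⟩, ⟨hVdB, hCdB⟩⟩, ⟨hHdB', ⟨hVdB', hCdB'⟩⟩⟩⟩⟩ := h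
  refine ⟨⟨?_, ?_⟩, ⟨?_, ?_⟩⟩
  · obtain ⟨s, y, H, hs, hy, hHs, hHo⟩ := exists_walk_of_mem_lrCrossingAt hω hH
    obtain ⟨s₀, y₀, H₀, hs₀, hy₀, hH₀s, hH₀o⟩ := exists_walk_of_mem_lrCrossingAt hω hH₀
    obtain ⟨p₀, q₀, V₀, hp₀, hq₀, hV₀s, hV₀o⟩ := exists_walk_of_mem_tbCrossingAt hω hV₀
    obtain ⟨p₁, q₁, V₁, hp₁, hq₁, hV₁s, hV₁o⟩ := exists_walk_of_mem_tbCrossingAt hω hV₁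
    obtain ⟨s₂, y₂, G₀, hs₂, hy₂, hG₀s, hG₀o⟩ := exists_walk_of_mem_lrCrossingAt hω hG₀
    obtain ⟨p₂, q₂, U₀, hp₂, hq₂, hU₀s, hU₀o⟩ := exists_walk_of_mem_tbCrossingAt hω hU₀
    obtain ⟨p₃, q₃, U, hp₃, hq₃, hUs, hUo⟩ := exists_walk_of_mem_tbCrossingAt hω hU
    simp only [Matrix.cons_val_zero, Matrix.cons_val_one] at hs hy hHs hs₀ hy₀ hH₀s
    simp only [Matrix.cons_val_zero, Matrix.cons_val_one] at hp₀ hq₀ hV₀s hp₁ hq₁ hV₁s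
    simp only [Matrix.cons_val_zero, Matrix.cons_val_one] at hs₂ hy₂ hG₀s hp₂ hq₂ hU₀s
    simp only [Matrix.cons_val_zero, Matrix.cons_val_one] at hp₃ hq₃ hUs
    exact exists_zdSepOpenArmR_init hm hmN H hs (by omega)
      (fun v hv => by have h := hHs v hv; exact ⟨by omega, by omega, by omega, by omega⟩) hHo
      H₀ hs₀ (by omega) (fun v hv => by have h := hH₀s v hv; exact ⟨by omega, by omega, by omega, by omega⟩) hH₀o
      V₀ hp₀ (by omega) (fun v hv => by have h := hV₀s v hv; exact ⟨by omega, by omega, by omega, by omega⟩) hV₀o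
      V₁ hp₁ (by omega) (fun v hv => by have h := hV₁s v hv; exact ⟨by omega, by omega, by omega, by omega⟩) hV₁o
      G₀ hs₂ (by omega) (fun v hv => by have h := hG₀s v hv; exact ⟨by omega, by omega, by omega, by omega⟩) hG₀o
      U₀ hp₂ (by omega) (fun v hv => by have h := hU₀s v hv; exact ⟨by omega, by omega, by omega, by omega⟩) hU₀o
      U hp₃ (by omega) (fun v hv => by have h := hUs v hv; exact ⟨by omega, by omega, by omega, by omega⟩) hUo
  · obtain ⟨s, y, H, hs, hy, hHs, hHo⟩ := exists_walk_of_mem_lrCrossingAt hω hHL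
    obtain ⟨s₀, y₀, H₀, hs₀, hy₀, hH₀s, hH₀o⟩ := exists_walk_of_mem_lrCrossingAt hω hH₀L
    obtain ⟨p₀, q₀, V₀, hp₀, hq₀, hV₀s, hV₀o⟩ := exists_walk_of_mem_tbCrossingAt hω hV₀L
    obtain ⟨p₁, q₁, V₁, hp₁, hq₁, hV₁s, hV₁o⟩ := exists_walk_of_mem_tbCrossingAt hω hV₁L
    obtain ⟨s₂, y₂, G₀, hs₂, hy₂, hG₀s, hG₀o⟩ := exists_walk_of_mem_lrCrossingAt hω hG₀L
    obtain ⟨p₂, q₂, U₀, hp₂, hq₂, hU₀s, hU₀o⟩ := exists_walk_of_mem_tbCrossingAt hω hU₀L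
    obtain ⟨p₃, q₃, U, hp₃, hq₃, hUs, hUo⟩ := exists_walk_of_mem_tbCrossingAt hω hUL
    simp only [Matrix.cons_val_zero, Matrix.cons_val_one] at hs hy hHs hs₀ hy₀ hH₀s
    simp only [Matrix.cons_val_zero, Matrix.cons_val_one] at hp₀ hq₀ hV₀s hp₁ hq₁ hV₁s
    simp only [Matrix.cons_val_zero, Matrix.cons_val_one] at hs₂ hy₂ hG₀s hp₂ hq₂ hU₀s
    simp only [Matrix.cons_val_zero, Matrix.cons_val_one] at hp₃ hq₃ hUs
    exact exists_zdSepOpenArmL_init hm hmN H.reverse (by omega) (by omega)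
      (fun v hv => by
        rw [Walk.support_reverse, List.mem_reverse] at hv
        have h := hHs v hv; exact ⟨by omega, by omega, by omega, by omega⟩)
      (fun e he => hHo e (by rwa [Walk.edges_reverse, List.mem_reverse] at he))
      H₀.reverse (by omega) (by omega)
      (fun v hv => by
        rw [Walk.support_reverse, List.mem_reverse] at hv
        have h := hH₀s v hv; exact ⟨by omega, by omega, by omega, by omega⟩)
      (fun e he => hH₀o e (by rwa [Walk.edges_reverse, List.mem_reverse] at he))
      V₀ hp₀ (by omega) (fun v hv => by have h := hV₀s v hv; exact ⟨by omega, by omega, by omega, by omega⟩) hV₀o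
      V₁ hp₁ (by omega) (fun v hv => by have h := hV₁s v hv; exact ⟨by omega, by omega, by omega, by omega⟩) hV₁o
      G₀.reverse (by omega) (by omega)
      (fun v hv => by
        rw [Walk.support_reverse, List.mem_reverse] at hv
        have h := hG₀s v hv; exact ⟨by omega, by omega, by omega, by omega⟩)
      (fun e he => hG₀o e (by rwa [Walk.edges_reverse, List.mem_reverse] at he))
      U₀ hp₂ (by omega) (fun v hv => by have h := hU₀s v hv; exact ⟨by omega, by omega, by omega, by omega⟩) hU₀o
      U hp₃ (by omega) (fun v hv => by have h := hUs v hv; exact ⟨by omega, by omega, by omega, by omega⟩) hUo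
  · obtain ⟨ka, kb, K, hka, hkb, hKs, hKc⟩ := hK
    obtain ⟨xa, xb, Hd, hxa, hxb, hHds, hHdc⟩ := hHd
    obtain ⟨va, vb, Vd, hva, hvb, hVds, hVdc⟩ := hVd
    obtain ⟨ya, yb, Cd, hya, hyb, hCds, hCdc⟩ := hCd
    obtain ⟨xa', xb', Hd', hxa', hxb', hHds', hHdc'⟩ := hHd'
    obtain ⟨va', vb', Vd', hva', hvb', hVds', hVdc'⟩ := hVd'
    obtain ⟨ya', yb', Cd', hya', hyb', hCds', hCdc'⟩ := hCd'
    simp only [Matrix.cons_val_zero, Matrix.cons_val_one] at hka hkb hKs hxa hxb hHds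
    simp only [Matrix.cons_val_zero, Matrix.cons_val_one] at hva hvb hVds hya hyb hCds
    simp only [Matrix.cons_val_zero, Matrix.cons_val_one] at hxa' hxb' hHds' hva' hvb' hVds'
    simp only [Matrix.cons_val_zero, Matrix.cons_val_one] at hya' hyb' hCds'
    exact exists_zdSepDualArmT_init hm hmN K (by omega) (by omega)
      (fun f hf => by have h := hKs f hf; exact ⟨by omega, by omega, by omega, by omega⟩) hKc
      Hd hxa (by omega) (fun f hf => by have h := hHds f hf; exact ⟨by omega, by omega, by omega, by omega⟩) hHdc
      Vd (by omega) (by omega) (fun f hf => by have h := hVds f hf; exact ⟨by omega, by omega, by omega, by omega⟩) hVdc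
      Cd hya (by omega) (fun f hf => by have h := hCds f hf; exact ⟨by omega, by omega, by omega, by omega⟩) hCdc
      Hd' hxa' (by omega) (fun f hf => by have h := hHds' f hf; exact ⟨by omega, by omega, by omega, by omega⟩) hHdc'
      Vd' (by omega) (by omega) (fun f hf => by have h := hVds' f hf; exact ⟨by omega, by omega, by omega, by omega⟩) hVdc'
      Cd' hya' (by omega) (fun f hf => by have h := hCds' f hf; exact ⟨by omega, by omega, by omega, by omega⟩) hCdc'
  · obtain ⟨ka, kb, K, hka, hkb, hKs, hKc⟩ := hKB
    obtain ⟨xa, xb, Hd, hxa, hxb, hHds, hHdc⟩ := hHdB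
    obtain ⟨va, vb, Vd, hva, hvb, hVds, hVdc⟩ := hVdB
    obtain ⟨ya, yb, Cd, hya, hyb, hCds, hCdc⟩ := hCdB
    obtain ⟨xa', xb', Hd', hxa', hxb', hHds', hHdc'⟩ := hHdB'
    obtain ⟨va', vb', Vd', hva', hvb', hVds', hVdc'⟩ := hVdB'
    obtain ⟨ya', yb', Cd', hya', hyb', hCds', hCdc'⟩ := hCdB'
    simp only [Matrix.cons_val_zero, Matrix.cons_val_one] at hka hkb hKs hxa hxb hHds
    simp only [Matrix.cons_val_zero, Matrix.cons_val_one] at hva hvb hVds hya hyb hCds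
    simp only [Matrix.cons_val_zero, Matrix.cons_val_one] at hxa' hxb' hHds' hva' hvb' hVds'
    simp only [Matrix.cons_val_zero, Matrix.cons_val_one] at hya' hyb' hCds'
    exact exists_zdSepDualArmB_init hm hmN K (by omega) (by omega)
      (fun f hf => by have h := hKs f hf; exact ⟨by omega, by omega, by omega, by omega⟩) hKc
      Hd hxa (by omega) (fun f hf => by have h := hHds f hf; exact ⟨by omega, by omega, by omega, by omega⟩) hHdc
      Vd (by omega) (by omega) (fun f hf => by have h := hVds f hf; exact ⟨by omega, by omega, by omega, by omega⟩) hVdc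
      Cd hya (by omega) (fun f hf => by have h := hCds f hf; exact ⟨by omega, by omega, by omega, by omega⟩) hCdc
      Hd' hxa' (by omega) (fun f hf => by have h := hHds' f hf; exact ⟨by omega, by omega, by omega, by omega⟩) hHdc'
      Vd' (by omega) (by omega) (fun f hf => by have h := hVds' f hf; exact ⟨by omega, by omega, by omega, by omega⟩) hVdc'
      Cd' hya' (by omega) (fun f hf => by have h := hCds' f hf; exact ⟨by omega, by omega, by omega, by omega⟩) hCdc'

end Events

end Literature.Probability.Percolation

end
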